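import Literature.NumberTheory.Sieve.QuadraticRootsTothDualZero
import Mathlib.Analysis.Calculus.Deriv.ZPow
import Mathlib.MeasureTheory.Measure.Haar.NormedSpace
import Mathlib.Analysis.Complex.ExponentialBounds
import HarnessLib

/-!
# The Poisson-dual Tóth sums: frequency tail, the column function along rays, dyadic partitions

Topic `Literature/NumberTheory/Sieve`, continuation of `QuadraticRootsTothColumnSum.lean` and
`QuadraticRootsTothDualZero.lean`; three parts of the descent of the dual-sum bound `HD`
(`…TothColumnSum.toth2000_quadraticRoots_primeModuli_of_dualBound`) to T. Ngo's Theorem 2.5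
(arXiv:2107.13301 §2.2, Pitt's bound for sums of Kloosterman sums), completed in
`QuadraticRootsTothPitt.lean`:  Part 1 truncates the frequencies (Ngo's Lemma 3.16), Part 2 studies
the column function along rays `t = us` (its `u`-derivatives, Ngo's Lemma 3.17 in the modulus
variable; the Fourier transform along rays; the sign symmetries of the complete sums `S_α(h, κ)`),
Part 3 builds the dyadic partitions of unity and the `±κ`, `±α` symmetries of the dual terms.
All statements are theorems (no named facts).

## Part 1. The tail of the Poisson-dual Tóth sums: truncation of the frequency range
  In the dual form
`T = ∑_{0<|α|≤A} M_α⁻¹ ∑_κ 𝓕(colFn(α,·))(κ/M_α) S_α(h,κ)` (`tothSum_eq_dualSum`; T. Ngo,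
arXiv:2107.13301, §3.5 Lemma 3.15) the frequencies `|κ| > q₀ d Y₁ x^η` contribute `O(1)`: this is
the truncation "we may restrict the `κ`-sum to `|κ| < (NY₁)^{1+ε}` modulo an admissible error term"
at the start of the proof of Ngo's Proposition 3.18, resting on Lemma 3.16
(`G_j(c,κ) ≪_R √x (NY₁/κ)^R`, `R`-fold integration by parts).  Here, in the tree's conventions:

* `exists_colFn_tothShift_support_lower` — for Tóth's shift `m_R` the column function vanishes
  unless `|u| ≥ c₀√x` (the window `ψ_R` excludes the direction `α = 0`; quantitative form of
  `…TothWeylSum.tothWeight_eq_zero_of_col`), so the derivative bounds of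
  `QuadraticRootsTothColumn.lean` apply on every non-empty column;
* `exists_norm_fourier_colFn_div_le` — **Ngo's Lemma 3.16**:
  `|𝓕(colFn(α,·))(κ/M_α)| ≤ C_n √x (d Y₁/|κ|)^n` for `κ ≠ 0`, uniformly in `α` (the tree's
  `FriedlanderIwaniecPrimes.norm_fourier_div_le` and `exists_integral_norm_iteratedDeriv_colFn_le`);
* `summable_norm_fourier_colFn_mul` — absolute convergence of the dual column sums;
* **`exists_dualTail_bound`** — for `K₀ ≥ q₀ d Y₁ x^η` the part `|κ| > K₀` of the dual sum is
  bounded by a constant (choose `n` with `η(n−1) ≥ 5/2`).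

## References

* T. Ngo, *On roots of quadratic congruences*, arXiv:2107.13301 (Bull. LMS 2024), §3.5
  Lemma 3.16, proof of Proposition 3.18 (the restriction `|κ| < (NY₁)^{1+ε}`).
  [cite: Ngo2024, §3.5 Lemma 3.16, Proposition 3.18]
* Á. Tóth, *Roots of quadratic congruences*, IMRN 2000, 719–739. [cite: Toth2000, §4]
-/

noncomputable section

namespace Literature.NumberTheory.Sieve

open scoped MatrixGroups
open Literature.NumberTheory.QuadraticFields.Quadratic (BinQF)
open Real Finset
open scoped FourierTransform

namespace RootForms

variable {R : BinQF} {a : ℤ}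

/-! ### The window of Tóth's shift excludes `|u| < c₀√x` -/

/-- `θ₋ ≠ 0` when `C ≠ 0` (`Aθ₊θ₋ = C`). [folklore] -/
theorem rootMinus_ne_zero (hA : R.a ≠ 0) (hΔ : 0 ≤ R.disc) (hc : R.c ≠ 0) : rootMinus R ≠ 0 := by
  intro h0
  have h := a_mul_root_prod hA hΔ
  rw [h0, mul_zero, mul_zero] at h
  exact hc (by exact_mod_cast h.symm)

/-- **Tóth's shift localises `|u| ≍ √x`**: for `m = m_R = tothShift R g₁` (`κ₁ = deckFactor R g₁
∈ (0,1)`, `L = log κ₁⁻¹`) there is `c₀ > 0` with `colFn(u,t) ≠ 0 ⇒ |u| ≥ c₀√x`.  Indeed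
`ψ ≠ 0` forces `|κ(u,t)| > e^{mL} > |θ₊/θ₋|`, while
`κ(u,t) − θ₊/θ₋ = u(θ₋ − θ₊)/(θ₋(u − tθ₋))` and `|u − tθ₋| ≥ c₁√x` on the support.
[cite: Ngo2024, §3.4 Lemma 3.11 (3)] -/
theorem exists_colFn_tothShift_support_lower (hA : R.a ≠ 0) (hΔ : 0 < R.disc)
    (hsq : ¬ IsSquare R.disc) (ha : 0 < a) {g₁ : SL(2, ℤ)} (hκ0 : 0 < deckFactor R g₁)
    (hκ1 : deckFactor R g₁ < 1) :
    ∃ c₀ : ℝ, 0 < c₀ ∧ ∀ (b : ℤ) (x Y₁ : ℝ) (h : ℤ) (u t : ℝ), 0 < x → 2 ≤ Y₁ →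
      colFn R a b x Y₁ h (Real.log (deckFactor R g₁)⁻¹) (tothShift R g₁) u t ≠ 0 →
        c₀ * Real.sqrt x ≤ |u| := by
  have hc : R.c ≠ 0 := c_ne_zero_of_not_isSquare hsq
  have hL : 0 < Real.log (deckFactor R g₁)⁻¹ := Real.log_pos ((one_lt_inv₀ hκ0).2 hκ1)
  set L := Real.log (deckFactor R g₁)⁻¹ with hLdef
  set m := tothShift R g₁ with hmdef
  obtain ⟨c₁, c₂, hc₁, hc₁₂, hcs⟩ := exists_colFn_support_consts hA hΔ ha hL m
  have hθ : rootMinus R ≠ 0 := rootMinus_ne_zero hA hΔ.le hc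
  have hθθ : rootPlus R ≠ rootMinus R := rootPlus_ne_rootMinus hA hΔ
  set q : ℝ := |rootPlus R / rootMinus R| with hq
  set E : ℝ := Real.exp (m * L) with hE
  -- `E > q`
  have hEq : q < E := by
    have hq0 : 0 < q := by
      rw [hq, abs_pos]
      refine div_ne_zero ?_ hθ
      intro h0
      have h := a_mul_root_prod hA hΔ.le
      rw [h0, zero_mul, mul_zero] at h
      exact hc (by exact_mod_cast h.symm)
    rw [hE, ← Real.exp_log hq0, Real.exp_lt_exp, hmdef, tothShift, ← hq, ← hLdef]
    have h1 := Int.lt_floor_add_one (Real.log q / L)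
    have h2 : Real.log q / L * L = Real.log q := div_mul_cancel₀ _ hL.ne'
    push_cast
    nlinarith
  set D : ℝ := |rootPlus R - rootMinus R| / |rootMinus R| with hD
  have hD0 : 0 < D := div_pos (abs_pos.2 (sub_ne_zero.2 hθθ)) (abs_pos.2 hθ)
  refine ⟨(E - q) * c₁ / (2 * D), by have := sub_pos.2 hEq; positivity, ?_⟩
  intro b x Y₁ h u t hx hY hF
  obtain ⟨⟨hP, hM⟩, -, hKlo, -⟩ := colFn_support hA hΔ ha hx hY hL hF
  obtain ⟨-, ⟨hM1, -⟩, -, -⟩ := hcs b x Y₁ h u t hx hY hF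
  have hsx : 0 < Real.sqrt x := Real.sqrt_pos.2 hx
  -- `|κ − θ₊/θ₋| ≤ |u| D / (c₁ √x)`
  have hdiff : colK R u t - rootPlus R / rootMinus R =
      u * (rootMinus R - rootPlus R) / (rootMinus R * (u - t * rootMinus R)) := by
    rw [colK]
    field_simp
    ring
  have hbound : |colK R u t| ≤ q + |u| * D / (c₁ * Real.sqrt x) := by
    have h1 : |colK R u t| ≤ q + |colK R u t - rootPlus R / rootMinus R| := by
      rw [hq]
      have := abs_add_le (rootPlus R / rootMinus R) (colK R u t - rootPlus R / rootMinus R)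
      rwa [add_sub_cancel] at this
    refine h1.trans (add_le_add le_rfl ?_)
    rw [hdiff, abs_div, abs_mul, abs_mul, hD]
    rw [show |rootMinus R - rootPlus R| = |rootPlus R - rootMinus R| from abs_sub_comm _ _]
    rw [div_le_div_iff₀ (mul_pos (abs_pos.2 hθ) (abs_pos.2 hM)) (by positivity)]
    have hθ0 : |rootMinus R| ≠ 0 := abs_ne_zero.2 hθ
    have e : |u| * (|rootPlus R - rootMinus R| / |rootMinus R|) * (|rootMinus R| * |u - t * rootMinus R|) =
        |u| * |rootPlus R - rootMinus R| * |u - t * rootMinus R| := by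
      field_simp
    rw [e]
    exact mul_le_mul_of_nonneg_left hM1 (by positivity)
  by_contra hlt
  rw [not_le] at hlt
  have h3 : |u| * D / (c₁ * Real.sqrt x) < (E - q) / 2 := by
    rw [div_lt_iff₀ (by positivity)]
    calc |u| * D < (E - q) * c₁ / (2 * D) * Real.sqrt x * D :=
          mul_lt_mul_of_pos_right hlt hD0
      _ = (E - q) / 2 * (c₁ * Real.sqrt x) := by field_simp
  have : E < |colK R u t| := hKlo
  linarith

/-! ### Fourier decay of the column functions (Ngo's Lemma 3.16) -/

/-- `𝓕 0 = 0`. [folklore] -/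
theorem fourier_zero_fun (w : ℝ) : 𝓕 (0 : ℝ → ℂ) w = 0 := by
  rw [Real.fourier_eq]; simp

/-- **`|𝓕(colFn(α,·))(κ/M_α)| ≤ C_n √x (d Y₁/|κ|)^n`** for `κ ≠ 0`, `M_α = |α| a d`, uniformly in the
column `α ≠ 0` (empty columns aside, `c₀√x ≤ |α| ≤ c₂√x`, and `n`-fold integration by parts with
`∫|∂ⁿ colFn| ≤ C (Y₁/√x)ⁿ √x`). [cite: Ngo2024, §3.5 Lemma 3.16] -/
theorem exists_norm_fourier_colFn_div_le (hA : R.a ≠ 0) (hΔ : 0 < R.disc) (hsq : ¬ IsSquare R.disc)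
    (ha : 0 < a) (b : ℤ) {g₁ : SL(2, ℤ)} (hκ0 : 0 < deckFactor R g₁) (hκ1 : deckFactor R g₁ < 1)
    (n : ℕ) {Ch : ℝ} (hCh : 0 ≤ Ch) :
    ∃ C : ℝ, 0 ≤ C ∧ ∀ (x Y₁ : ℝ) (h : ℤ), 0 < x → 2 ≤ Y₁ → |(h : ℝ)| ≤ Ch * x →
      ∀ (d : ℕ), 1 ≤ d → ∀ (α : ℤ), α ≠ 0 → ∀ κ : ℤ, κ ≠ 0 →
        ‖𝓕 (fun t => colFn R a b x Y₁ h (Real.log (deckFactor R g₁)⁻¹) (tothShift R g₁) α t)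
            ((κ : ℝ) / ((α.natAbs * (a.toNat * d) : ℕ) : ℝ))‖ ≤
          C * Real.sqrt x * ((d : ℝ) * Y₁ / |(κ : ℝ)|) ^ n := by
  have hL : 0 < Real.log (deckFactor R g₁)⁻¹ := Real.log_pos ((one_lt_inv₀ hκ0).2 hκ1)
  obtain ⟨c₀, hc₀, hlow⟩ := exists_colFn_tothShift_support_lower hA hΔ hsq ha hκ0 hκ1
  obtain ⟨c₁, c₂, hc₁, hc₁₂, hcs⟩ := exists_colFn_support_consts hA hΔ ha hL (tothShift R g₁)
  have hc₂ : 0 < c₂ := hc₁.trans_le hc₁₂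
  obtain ⟨C₁, hC₁0, hC₁⟩ :=
    exists_integral_norm_iteratedDeriv_colFn_le hA hΔ ha b hL (tothShift R g₁) n hCh hc₀
  have ha' : (0 : ℝ) < a.toNat := by
    have : 0 < a.toNat := by omega
    exact_mod_cast this
  refine ⟨C₁ * (c₂ * a.toNat / (2 * Real.pi)) ^ n, by positivity, ?_⟩
  intro x Y₁ h hx hY hh d hd α hα κ hκ
  have hsx : 0 < Real.sqrt x := Real.sqrt_pos.2 hx
  have hd0 : (0 : ℝ) < d := by exact_mod_cast hd
  have hY0 : 0 < Y₁ := by linarith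
  set M : ℕ := α.natAbs * (a.toNat * d) with hMdef
  have hn0 : 0 < α.natAbs := Int.natAbs_pos.2 hα
  have hM0 : (0 : ℝ) < (M : ℝ) := by rw [hMdef]; push_cast; positivity
  have hκ0 : 0 < |(κ : ℝ)| := abs_pos.2 (by exact_mod_cast hκ)
  set F : ℝ → ℂ := fun t => colFn R a b x Y₁ h (Real.log (deckFactor R g₁)⁻¹) (tothShift R g₁) α t
    with hFdef
  by_cases hex : ∃ t, F t ≠ 0
  · -- a non-empty column: `c₀√x ≤ |α| ≤ c₂√x`
    obtain ⟨t₀, ht₀⟩ := hex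
    have hαlo : c₀ * Real.sqrt x ≤ |(α : ℝ)| := hlow b x Y₁ h α t₀ hx hY ht₀
    have hαhi : |(α : ℝ)| ≤ c₂ * Real.sqrt x := (hcs b x Y₁ h α t₀ hx hY ht₀).2.2.2
    have hFd : ContDiff ℝ ((⊤ : ℕ∞) : WithTop ℕ∞) F := contDiff_colFn_col hA hΔ ha b hx hY h hL _ hα
    have hFc : HasCompactSupport F := hasCompactSupport_colFn hA hΔ ha b hx hY h hL _ _
    have h1 := FriedlanderIwaniecPrimes.norm_fourier_div_le hFd hFc n hM0 hκ0
    have h2 := hC₁ x Y₁ h α hx hY hh hαlo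
    refine h1.trans ?_
    have hMle : (M : ℝ) ≤ c₂ * Real.sqrt x * (a.toNat * d) := by
      rw [hMdef]; push_cast
      rw [natCast_natAbs_real]
      exact mul_le_mul_of_nonneg_right hαhi (by positivity)
    calc (∫ t, ‖iteratedDeriv n F t‖) * ((M : ℝ) / (2 * Real.pi)) ^ n * (|(κ : ℝ)| ^ n)⁻¹
        ≤ (C₁ * (Y₁ / Real.sqrt x) ^ n * Real.sqrt x) *
            ((c₂ * Real.sqrt x * (a.toNat * d)) / (2 * Real.pi)) ^ n * (|(κ : ℝ)| ^ n)⁻¹ := by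
          gcongr
    _ = C₁ * (c₂ * a.toNat / (2 * Real.pi)) ^ n * Real.sqrt x * ((d : ℝ) * Y₁ / |(κ : ℝ)|) ^ n := by
          have hsxn : Real.sqrt x ≠ 0 := hsx.ne'
          have e1 : (Y₁ / Real.sqrt x) ^ n * ((c₂ * Real.sqrt x * (a.toNat * d)) / (2 * Real.pi)) ^ n =
              (c₂ * a.toNat / (2 * Real.pi)) ^ n * ((d : ℝ) * Y₁) ^ n := by
            rw [← mul_pow, ← mul_pow]
            congr 1
            field_simp
          rw [div_pow ((d : ℝ) * Y₁), div_eq_mul_inv (((d : ℝ) * Y₁) ^ n)]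
          calc C₁ * (Y₁ / Real.sqrt x) ^ n * Real.sqrt x *
                ((c₂ * Real.sqrt x * (a.toNat * d)) / (2 * Real.pi)) ^ n * (|(κ : ℝ)| ^ n)⁻¹
              = C₁ * Real.sqrt x * ((Y₁ / Real.sqrt x) ^ n *
                  ((c₂ * Real.sqrt x * (a.toNat * d)) / (2 * Real.pi)) ^ n) * (|(κ : ℝ)| ^ n)⁻¹ := by ring
            _ = C₁ * Real.sqrt x * ((c₂ * a.toNat / (2 * Real.pi)) ^ n * ((d : ℝ) * Y₁) ^ n) *
                  (|(κ : ℝ)| ^ n)⁻¹ := by rw [e1]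
            _ = _ := by ring
  · -- an empty column
    push Not at hex
    have hF0 : F = 0 := funext fun t => hex t
    rw [hF0, fourier_zero_fun, norm_zero]
    positivity

/-- The dual column sum converges absolutely. [folklore] -/
theorem summable_norm_fourier_colFn_mul (hA : R.a ≠ 0) (hΔ : 0 < R.disc) (ha : 0 < a) (b : ℤ)
    {x Y₁ : ℝ} (hx : 0 < x) (hY : 2 ≤ Y₁) (h : ℤ) {L : ℝ} (hL : 0 < L) (m : ℤ) {α : ℤ} (hα : α ≠ 0)
    {d : ℕ} (hd : 1 ≤ d) :
    Summable fun κ : ℤ =>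
      ‖𝓕 (fun t => colFn R a b x Y₁ h L m α t) ((κ : ℝ) / ((α.natAbs * (a.toNat * d) : ℕ) : ℝ))‖ *
        ‖colExpSum a d R h α κ‖ := by
  have hn0 : 0 < α.natAbs := Int.natAbs_pos.2 hα
  have hM0 : (0 : ℝ) < ((α.natAbs * (a.toNat * d) : ℕ) : ℝ) := by
    push_cast
    have : (0 : ℝ) < a.toNat := by
      have : 0 < a.toNat := by omega
      exact_mod_cast this
    have : (0 : ℝ) < d := by exact_mod_cast hd
    positivity
  have hs := (FriedlanderIwaniecPrimes.summable_fourier_div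
    (contDiff_colFn_col hA hΔ ha b hx hY h hL m hα)
    (hasCompactSupport_colFn hA hΔ ha b hx hY h hL m _) hM0).norm.mul_right
    (((α.natAbs * (a.toNat * d) : ℕ) : ℝ))
  refine Summable.of_nonneg_of_le (fun κ => by positivity) (fun κ => ?_) hs
  exact mul_le_mul_of_nonneg_left (norm_colExpSum_le a d R h α κ) (norm_nonneg _)

/-! ### The tail -/

/-- A tail over `ℤ` through its symmetric envelope: if `0 ≤ g κ ≤ G |κ|` with `G ≥ 0` vanishing
on `[0, K]` and `∑_{K < k ≤ N} G k ≤ B` for all `N`, then `∑'_κ g κ ≤ 2B`. [folklore] -/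
theorem tsum_int_le_of_envelope {g : ℤ → ℝ} {G : ℕ → ℝ} (hgG : ∀ κ, g κ ≤ G κ.natAbs)
    (hG0 : ∀ k, 0 ≤ G k) {K : ℕ} (hGK : ∀ k, k ≤ K → G k = 0)
    {B : ℝ} (hB : ∀ N, ∑ k ∈ Finset.Ioc K N, G k ≤ B) (hs : Summable g) :
    ∑' κ, g κ ≤ 2 * B := by
  classical
  have hB0 : 0 ≤ B := by simpa using hB K
  refine hs.tsum_le_of_sum_le fun s => ?_
  set N := s.sup Int.natAbs with hN
  set F : ℕ → ℝ := fun k => if k ≤ N then G k else 0 with hF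
  have hF0 : ∀ k, 0 ≤ F k := fun k => by rw [hF]; simp only; split_ifs; exacts [hG0 k, le_rfl]
  have hFN : ∀ k, N < k → F k = 0 := fun k hk => by rw [hF]; simp only; rw [if_neg (not_le.2 hk)]
  calc ∑ κ ∈ s, g κ ≤ ∑ κ ∈ s, G κ.natAbs := Finset.sum_le_sum fun κ _ => hgG κ
    _ = ∑ κ ∈ s.erase 0, G κ.natAbs := (Finset.sum_erase s (by exact hGK 0 (Nat.zero_le K))).symm
    _ = ∑ κ ∈ s.erase 0, F κ.natAbs := by
        refine Finset.sum_congr rfl fun κ hκ => ?_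
        rw [hF]; simp only
        rw [if_pos (Finset.le_sup (Finset.mem_of_mem_erase hκ))]
    _ ≤ 2 * ∑ k ∈ Finset.Icc 1 N, F k :=
        sum_natAbs_le_two_mul_sum (fun κ hκ => Finset.ne_of_mem_erase hκ) hF0 hFN
    _ ≤ 2 * ∑ k ∈ Finset.Icc 1 N, G k := by
        refine mul_le_mul_of_nonneg_left (Finset.sum_le_sum fun k _ => ?_) (by norm_num)
        rw [hF]; simp only; split_ifs; exacts [le_rfl, hG0 k]
    _ ≤ 2 * B := by
        refine mul_le_mul_of_nonneg_left ?_ (by norm_num)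
        -- the terms `k ≤ K` vanish, the rest is a sum over `Ioc K N`
        have hsplit : ∑ k ∈ Finset.Icc 1 N, G k = ∑ k ∈ (Finset.Icc 1 N).filter (fun k => K < k), G k := by
          rw [Finset.sum_filter]
          refine Finset.sum_congr rfl fun k _ => ?_
          split_ifs with hk
          · rfl
          · exact hGK k (not_lt.1 hk)
        rw [hsplit]
        refine le_trans ?_ (hB N)
        refine Finset.sum_le_sum_of_subset_of_nonneg (fun k hk => ?_) (fun k _ _ => hG0 k)
        rw [Finset.mem_filter, Finset.mem_Icc] at hk
        rw [Finset.mem_Ioc]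
        exact ⟨hk.2, hk.1.2⟩

set_option maxHeartbeats 400000 in
/-- **The tail `|κ| > K₀ ≥ q₀ d Y₁ x^η` of the dual sum is bounded** (for the data of `HD`): with
`q₀ = 1` and `n = n(η)` large, `∑_{0<|α|≤A} M_α⁻¹ ∑_{|κ| > K₀} |𝓕(colFn(α,·))(κ/M_α)| |S_α(h,κ)| ≤ K`
— Ngo's restriction of the frequency range at the start of the proof of Proposition 3.18
("modulo an admissible error term", here `O(1)`; the trivial bound `|S_α| ≤ M_α` and Lemma 3.16).
[cite: Ngo2024, §3.5 Proposition 3.18 (proof, the restriction |κ| < (NY₁)^{1+ε}), Lemma 3.16] -/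
theorem exists_dualTail_bound {b c : ℤ} (ha : 0 < a) (hΔ : 0 < discrim a b c)
    (hsq : ¬ IsSquare (discrim a b c)) (hR : IsLevelForm a b (discrim a b c) a.toNat R) (hRa : R.a ≠ 0)
    {g₁ : SL(2, ℤ)} (hg₁ : g₁ ∈ stabLevel R a.toNat) (hκ : deckFactor R g₁ < 1) {η : ℝ} (hη : 0 < η)
    {Ch : ℝ} (hCh : 0 < Ch) :
    ∃ K : ℝ, 0 ≤ K ∧ ∀ x Y₁ : ℝ, 2 ≤ Y₁ → Y₁ ≤ x → ∀ d : ℕ, 1 ≤ d → (d : ℝ) ^ 2 ≤ x →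
      ∀ h : ℤ, h ≠ 0 → |(h : ℝ)| ≤ Ch * x → ∀ A : ℤ, ∀ K₀ : ℝ, (d : ℝ) * Y₁ * x ^ η ≤ K₀ →
        ∑ α ∈ (Finset.Icc (-A) A).erase 0, (((α.natAbs * (a.toNat * d) : ℕ) : ℝ))⁻¹ *
            ∑' κ : ℤ, (if K₀ < |(κ : ℝ)| then
              ‖𝓕 (fun t => colFn R a b x Y₁ h (Real.log (deckFactor R g₁)⁻¹) (tothShift R g₁) α t)
                  ((κ : ℝ) / ((α.natAbs * (a.toNat * d) : ℕ) : ℝ))‖ * ‖colExpSum a d R h α κ‖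
              else 0) ≤ K := by
  classical
  have hΔR : 0 < R.disc := by rw [hR.disc_eq]; exact hΔ
  have hsqR : ¬ IsSquare R.disc := by rw [hR.disc_eq]; exact hsq
  have hκ0 : 0 < deckFactor R g₁ := deckFactor_pos hRa hΔR.le hg₁.1
  have hL : 0 < Real.log (deckFactor R g₁)⁻¹ := Real.log_pos ((one_lt_inv₀ hκ0).2 hκ)
  obtain ⟨c₁, c₂, hc₁, hc₁₂, hcs⟩ := exists_colFn_support_consts hRa hΔR ha hL (tothShift R g₁)
  have hc₂ : 0 < c₂ := hc₁.trans_le hc₁₂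
  -- the order of integration by parts: `n = m + 1`, `η m ≥ 5/2`
  set m : ℕ := ⌈5 / (2 * η)⌉₊ + 1 with hmdef
  have hm1 : 1 ≤ m := by omega
  have hηm : 5 / 2 ≤ η * m := by
    have h1 : 5 / (2 * η) ≤ ⌈5 / (2 * η)⌉₊ := Nat.le_ceil _
    have h2 : (5 / (2 * η) : ℝ) ≤ m := by rw [hmdef]; push_cast; linarith
    have h3 : 5 / (2 * η) * η = 5 / 2 := by field_simp
    nlinarith
  obtain ⟨C, hC0, hC⟩ := exists_norm_fourier_colFn_div_le hRa hΔR hsqR ha b hκ0 hκ (m + 1) hCh.le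
  refine ⟨2 * c₂ * (2 * (C * 2 ^ m)) + 1, by positivity, ?_⟩
  intro x Y₁ hY hYx d hd hdx h hh hhx A K₀ hK₀
  have hx1 : 1 ≤ x := by linarith
  have hx0 : 0 < x := by linarith
  have hsx0 : 0 < Real.sqrt x := Real.sqrt_pos.2 hx0
  have hsx1 : 1 ≤ Real.sqrt x := by
    rw [show (1 : ℝ) = Real.sqrt 1 from Real.sqrt_one.symm]; exact Real.sqrt_le_sqrt hx1
  have hd0 : (0 : ℝ) < d := by exact_mod_cast hd
  have hd1 : (1 : ℝ) ≤ d := by exact_mod_cast hd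
  have hY1 : 1 ≤ Y₁ := by linarith
  have hxη : 1 ≤ x ^ η := Real.one_le_rpow hx1 hη.le
  have hdY : 2 ≤ (d : ℝ) * Y₁ := by nlinarith
  have hK₀2 : 2 ≤ K₀ := by nlinarith
  have hdsx : (d : ℝ) ≤ Real.sqrt x := by
    rw [show (d : ℝ) = Real.sqrt ((d : ℝ) ^ 2) by rw [Real.sqrt_sq hd0.le]]
    exact Real.sqrt_le_sqrt hdx
  have ha' : (0 : ℝ) < a.toNat := by
    have : 0 < a.toNat := by omega
    exact_mod_cast this
  -- `⌊K₀⌋₊ ≥ K₀/2 ≥ 1`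
  set Kn : ℕ := ⌊K₀⌋₊ with hKn
  have hKn1 : 1 ≤ Kn := by rw [hKn]; exact Nat.le_floor (by norm_num; linarith)
  have hKnlo : K₀ / 2 ≤ Kn := by
    have := Nat.lt_floor_add_one K₀
    rw [← hKn] at this
    linarith
  have hKn0 : (0 : ℝ) < Kn := by exact_mod_cast hKn1
  -- the per-column bound
  set bnd : ℝ := 2 * (C * Real.sqrt x * ((d : ℝ) * Y₁) ^ (m + 1) * ((Kn : ℝ) ^ m)⁻¹) with hbnd
  have hbnd0 : 0 ≤ bnd := by rw [hbnd]; positivity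
  have hcol : ∀ α ∈ (Finset.Icc (-A) A).erase 0, (((α.natAbs * (a.toNat * d) : ℕ) : ℝ))⁻¹ *
      ∑' κ : ℤ, (if K₀ < |(κ : ℝ)| then
        ‖𝓕 (fun t => colFn R a b x Y₁ h (Real.log (deckFactor R g₁)⁻¹) (tothShift R g₁) α t)
            ((κ : ℝ) / ((α.natAbs * (a.toNat * d) : ℕ) : ℝ))‖ * ‖colExpSum a d R h α κ‖ else 0) ≤
      (if (α.natAbs : ℝ) ≤ c₂ * Real.sqrt x then bnd else 0) := by
    intro α hα
    have hα0 : α ≠ 0 := Finset.ne_of_mem_erase hα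
    set M : ℕ := α.natAbs * (a.toNat * d) with hMdef
    have hn0 : 0 < α.natAbs := Int.natAbs_pos.2 hα0
    have hM0 : (0 : ℝ) < (M : ℝ) := by rw [hMdef]; push_cast; positivity
    set F : ℝ → ℂ := fun t => colFn R a b x Y₁ h (Real.log (deckFactor R g₁)⁻¹) (tothShift R g₁) α t
      with hFdef
    -- summability of the truncated series
    have hsum0 := summable_norm_fourier_colFn_mul hRa hΔR ha b hx0 hY h hL (tothShift R g₁) hα0 hd
    have hsum : Summable fun κ : ℤ => (if K₀ < |(κ : ℝ)| then
        ‖𝓕 F ((κ : ℝ) / (M : ℝ))‖ * ‖colExpSum a d R h α κ‖ else 0) := by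
      refine Summable.of_nonneg_of_le (fun κ => by positivity) (fun κ => ?_) hsum0
      split_ifs
      · exact le_rfl
      · positivity
    by_cases hex : ∃ t, F t ≠ 0
    · obtain ⟨t₀, ht₀⟩ := hex
      have hαhi : |(α : ℝ)| ≤ c₂ * Real.sqrt x := (hcs b x Y₁ h α t₀ hx0 hY ht₀).2.2.2
      rw [if_pos (by rwa [natCast_natAbs_real])]
      -- envelope `G(k) = [K₀ < k] C √x (dY₁/k)^{m+1} M`
      set G : ℕ → ℝ := fun k => if K₀ < (k : ℝ) then
        C * Real.sqrt x * ((d : ℝ) * Y₁ / k) ^ (m + 1) * M else 0 with hGdef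
      have hG0 : ∀ k, 0 ≤ G k := fun k => by rw [hGdef]; positivity
      have hgG : ∀ κ : ℤ, (if K₀ < |(κ : ℝ)| then ‖𝓕 F ((κ : ℝ) / (M : ℝ))‖ * ‖colExpSum a d R h α κ‖
          else 0) ≤ G κ.natAbs := by
        intro κ
        rw [hGdef]; simp only
        rw [natCast_natAbs_real]
        split_ifs with hlt
        · have hκ0 : κ ≠ 0 := by rintro rfl; simp at hlt; linarith
          refine mul_le_mul (hC x Y₁ h hx0 hY hhx d hd α hα0 κ hκ0) ?_ (norm_nonneg _) (by positivity)
          exact_mod_cast norm_colExpSum_le a d R h α κ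
        · exact le_rfl
      have hGK : ∀ k, k ≤ Kn → G k = 0 := by
        intro k hk
        rw [hGdef]; simp only
        rw [if_neg]
        have : (k : ℝ) ≤ Kn := by exact_mod_cast hk
        have := Nat.floor_le (show 0 ≤ K₀ by linarith)
        rw [← hKn] at this
        linarith
      have hB : ∀ N, ∑ k ∈ Finset.Ioc Kn N, G k ≤
          C * Real.sqrt x * ((d : ℝ) * Y₁) ^ (m + 1) * M * ((Kn : ℝ) ^ m)⁻¹ := by
        intro N
        calc ∑ k ∈ Finset.Ioc Kn N, G k
            ≤ ∑ k ∈ Finset.Ioc Kn N, C * Real.sqrt x * ((d : ℝ) * Y₁) ^ (m + 1) * M * (((k : ℝ)) ^ (m + 1))⁻¹ := by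
              refine Finset.sum_le_sum fun k hk => ?_
              rw [Finset.mem_Ioc] at hk
              have hk0 : (0 : ℝ) < k := by exact_mod_cast (show 0 < k by omega)
              rw [hGdef]; simp only
              split_ifs
              · rw [div_pow]; apply le_of_eq; field_simp
              · positivity
          _ = C * Real.sqrt x * ((d : ℝ) * Y₁) ^ (m + 1) * M *
                ∑ k ∈ Finset.Ioc Kn N, ((k : ℝ) ^ (m + 1))⁻¹ := by rw [Finset.mul_sum]
          _ ≤ C * Real.sqrt x * ((d : ℝ) * Y₁) ^ (m + 1) * M * ((Kn : ℝ) ^ m)⁻¹ := by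
              refine mul_le_mul_of_nonneg_left ?_ (by positivity)
              have := FriedlanderIwaniecPrimes.sum_Ioc_inv_pow_le (n := m + 1) (by omega) hKn1 N
              rwa [Nat.add_sub_cancel] at this
      have htail := tsum_int_le_of_envelope hgG hG0 hGK hB hsum
      calc (M : ℝ)⁻¹ * ∑' κ : ℤ, (if K₀ < |(κ : ℝ)| then
              ‖𝓕 F ((κ : ℝ) / (M : ℝ))‖ * ‖colExpSum a d R h α κ‖ else 0)
          ≤ (M : ℝ)⁻¹ * (2 * (C * Real.sqrt x * ((d : ℝ) * Y₁) ^ (m + 1) * M * ((Kn : ℝ) ^ m)⁻¹)) :=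
            mul_le_mul_of_nonneg_left htail (inv_nonneg.2 hM0.le)
        _ = bnd := by rw [hbnd]; field_simp
    · push Not at hex
      have hF0 : F = 0 := funext fun t => hex t
      have hzero : ∀ κ : ℤ, (if K₀ < |(κ : ℝ)| then ‖𝓕 F ((κ : ℝ) / (M : ℝ))‖ * ‖colExpSum a d R h α κ‖
          else 0) = 0 := by
        intro κ
        rw [hF0, fourier_zero_fun, norm_zero, zero_mul, ite_self]
      rw [tsum_congr hzero, tsum_zero, mul_zero]
      split_ifs <;> positivity
  -- sum over the columns
  refine (Finset.sum_le_sum hcol).trans ?_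
  set N : ℕ := ⌊c₂ * Real.sqrt x⌋₊ with hNdef
  have hcount : ∑ α ∈ (Finset.Icc (-A) A).erase 0, (if (α.natAbs : ℝ) ≤ c₂ * Real.sqrt x then bnd else 0)
      ≤ 2 * ∑ k ∈ Finset.Icc 1 N, (if ((k : ℕ) : ℝ) ≤ c₂ * Real.sqrt x then bnd else 0) := by
    refine sum_natAbs_le_two_mul_sum (F := fun k : ℕ => if ((k : ℕ) : ℝ) ≤ c₂ * Real.sqrt x then bnd else 0)
      (fun α hα => Finset.ne_of_mem_erase hα) (fun k => by positivity) (fun k hk => ?_)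
    rw [if_neg]
    intro hle
    have : k ≤ N := by rw [hNdef]; exact Nat.le_floor hle
    omega
  refine hcount.trans ?_
  have hN : (N : ℝ) ≤ c₂ * Real.sqrt x := Nat.floor_le (by positivity)
  calc 2 * ∑ k ∈ Finset.Icc 1 N, (if ((k : ℕ) : ℝ) ≤ c₂ * Real.sqrt x then bnd else 0)
      ≤ 2 * ∑ _k ∈ Finset.Icc 1 N, bnd := by
        refine mul_le_mul_of_nonneg_left (Finset.sum_le_sum fun k _ => ?_) (by norm_num)
        split_ifs <;> linarith
    _ = 2 * (N * bnd) := by rw [Finset.sum_const, Nat.card_Icc, Nat.add_sub_cancel, nsmul_eq_mul]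
    _ ≤ 2 * (c₂ * Real.sqrt x * bnd) := by gcongr
    _ = 2 * c₂ * (2 * (C * (((d : ℝ) * Y₁) ^ (m + 1) * ((Kn : ℝ) ^ m)⁻¹ * (Real.sqrt x * Real.sqrt x)))) := by
        rw [hbnd]; ring
    _ ≤ 2 * c₂ * (2 * (C * 2 ^ m)) + 1 := by
        have hkey : ((d : ℝ) * Y₁) ^ (m + 1) * ((Kn : ℝ) ^ m)⁻¹ * (Real.sqrt x * Real.sqrt x) ≤ 2 ^ m := by
          rw [Real.mul_self_sqrt hx0.le]
          -- `(dY₁)^{m+1} / Kn^m ≤ (dY₁)^{m+1} (2/K₀)^m ≤ dY₁ 2^m x^{-η m}`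
          have h1 : ((Kn : ℝ) ^ m)⁻¹ ≤ (2 / K₀) ^ m := by
            rw [← inv_pow, ← one_div]
            refine pow_le_pow_left₀ (by positivity) ?_ m
            rw [div_le_div_iff₀ hKn0 (by linarith), one_mul]
            linarith
          have h2 : ((d : ℝ) * Y₁) ^ (m + 1) * (2 / K₀) ^ m ≤ (d : ℝ) * Y₁ * (2 ^ m * (x ^ (η * m))⁻¹) := by
            have hxη0 : 0 < x ^ η := Real.rpow_pos_of_pos hx0 _
            have hq : 2 * ((d : ℝ) * Y₁) / K₀ ≤ 2 / x ^ η := by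
              rw [div_le_div_iff₀ (by linarith) hxη0]
              nlinarith
            have hpow : (2 * ((d : ℝ) * Y₁) / K₀) ^ m ≤ (2 / x ^ η) ^ m :=
              pow_le_pow_left₀ (by positivity) hq m
            have hxm : (2 / x ^ η) ^ m = 2 ^ m * (x ^ (η * m))⁻¹ := by
              rw [div_pow, Real.rpow_mul hx0.le, Real.rpow_natCast, div_eq_mul_inv]
            have e : ((d : ℝ) * Y₁) ^ (m + 1) * (2 / K₀) ^ m =
                (d : ℝ) * Y₁ * (2 * ((d : ℝ) * Y₁) / K₀) ^ m := by
              rw [pow_succ, div_pow, div_pow, mul_pow]; ring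
            rw [e, ← hxm]
            exact mul_le_mul_of_nonneg_left hpow (by positivity)
          have h3 : (d : ℝ) * Y₁ * (2 ^ m * (x ^ (η * m))⁻¹) * x ≤ 2 ^ m := by
            -- `d Y₁ x ≤ x^{1/2} x x = x^{5/2} ≤ x^{η m}`
            have h4 : (d : ℝ) * Y₁ * x ≤ x ^ (η * m) := by
              calc (d : ℝ) * Y₁ * x ≤ Real.sqrt x * x * x := by gcongr
                _ = x ^ (5 / 2 : ℝ) := by
                    rw [Real.sqrt_eq_rpow, show (5 / 2 : ℝ) = 1 / 2 + 1 + 1 by norm_num,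
                      Real.rpow_add hx0, Real.rpow_add hx0, Real.rpow_one]
                _ ≤ x ^ (η * m) := Real.rpow_le_rpow_of_exponent_le hx1 hηm
            have hxη0 : 0 < x ^ (η * m) := Real.rpow_pos_of_pos hx0 _
            calc (d : ℝ) * Y₁ * (2 ^ m * (x ^ (η * m))⁻¹) * x
                = 2 ^ m * ((d : ℝ) * Y₁ * x / x ^ (η * m)) := by field_simp
              _ ≤ 2 ^ m * 1 := by
                  refine mul_le_mul_of_nonneg_left ?_ (by positivity)
                  rwa [div_le_one hxη0]
              _ = 2 ^ m := mul_one _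
          calc ((d : ℝ) * Y₁) ^ (m + 1) * ((Kn : ℝ) ^ m)⁻¹ * x
              ≤ ((d : ℝ) * Y₁) ^ (m + 1) * (2 / K₀) ^ m * x := by gcongr
            _ ≤ (d : ℝ) * Y₁ * (2 ^ m * (x ^ (η * m))⁻¹) * x := by gcongr
            _ ≤ 2 ^ m := h3
        have : 2 * c₂ * (2 * (C * (((d : ℝ) * Y₁) ^ (m + 1) * ((Kn : ℝ) ^ m)⁻¹ * (Real.sqrt x * Real.sqrt x))))
            ≤ 2 * c₂ * (2 * (C * 2 ^ m)) := by gcongr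
        linarith

end RootForms

end Literature.NumberTheory.Sieve

/-!
## Part 2. The column function along rays: `colFn(u, us)`

Topic `Literature/NumberTheory/Sieve`, continuation of `QuadraticRootsTothColumn.lean` and of
Part 1.  To feed the Poisson-dual Tóth sums
`∑_α M_α⁻¹ ∑_κ 𝓕(colFn(α,·))(κ/M_α) S_α(h,κ)` (`…TothColumnSum.tothSum_eq_dualSum`) into a bound of
the shape of T. Ngo's Theorem 2.5 (arXiv:2107.13301; Pitt's bound for sums of Kloosterman sums with
a smooth weight `V(c, κ)` in the modulus and the frequency), Ngo keeps the Poisson variable `y`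
un-integrated and applies the bound to `g_j(c, κ, y)` for each `y` (proof of Proposition 3.18).
In the tree's first-column conventions the cleanest version of this device is to integrate along
RAYS `t = u s` through the origin: by homogeneity of the form,

* `colA(u, us) = u² colA(1, s)`, `colK(u, us) = colK(1, s)` (so Tóth's weight `ψ` is CONSTANT along
  a ray), `colPhi(u, us) = c_s u⁻²` with `c_s = (B + 2Cs − b)/(2 colA(1,s))` (`colFn_ray`), and
  `colFn(−u, −t) = colFn(u, t)` (`colFn_neg_neg`);
* `fourier_colFn_eq_ray` — `𝓕(colFn(α,·))(κ/M_α) = |α| ∫ e(−sgn(α) s κ/(ad)) colFn(|α|, |α|s) ds`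
  (`M_α = |α| a d`; the substitution `t = αs`), in which the modulus `u = |α|` and the frequency
  `κ` are DECOUPLED: the weight is a product `f_s(u) g_s(κ)`;
* **`exists_norm_iteratedDeriv_colFn_ray_le`** — along a ray the column function
  `u ↦ colFn(u, us) = G(u² r_s/a) · e(h c_s/u²) · ψ_s` has `‖∂ⁿ_u‖ ≤ A_n (Y₁/|u|)ⁿ` uniformly in
  `x > 0`, `Y₁ ≥ 2`, `|h| ≤ C_h x`, `|s| ≤ S`, `u ≠ 0` (Ngo's Lemma 3.17 / 3.20–3.22 in these
  coordinates: a quadratic inner map for the plateau, the monomial `u⁻²` for the phase);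
* the symmetries of the complete sums needed to reduce all signs of `α, κ` to Theorem 2.5's
  `c > 0`, `κ > 0`: `colExpSum_neg_left` (`S_{−α}(h,κ) = S_α(h,−κ)`) and `conj_colExpSum`
  (`conj S_α(h,κ) = S_α(−h,−κ)`).

## References

* T. Ngo, *On roots of quadratic congruences*, arXiv:2107.13301 (Bull. LMS 2024), §3.5
  Lemmas 3.15–3.17, Proposition 3.18, §3.6 Lemmas 3.20–3.22. [cite: Ngo2024, §3.5 Lemma 3.17, Proposition 3.18]
* Á. Tóth, *Roots of quadratic congruences*, IMRN 2000, 719–739. [cite: Toth2000, §4]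
-/

noncomputable section

namespace Literature.NumberTheory.Sieve

open scoped MatrixGroups ContDiff FourierTransform
open Literature.NumberTheory.QuadraticFields.Quadratic (BinQF)
open Literature.NumberTheory.Sieve.FriedlanderIwaniecPrimes (smoothTransitionC
  norm_iteratedFDeriv_smoothTransitionC_le contDiff_smoothTransitionC
  exists_bound_iteratedFDeriv_smoothTransition)
open Real Finset MeasureTheory

namespace RootForms

variable {R : BinQF}

/-! ### Homogeneity: the column function along a ray -/

/-- `colA(u, us) = u² colA(1, s)`. [folklore] -/
theorem colA_ray (R : BinQF) (u s : ℝ) : colA R u (u * s) = u ^ 2 * colA R 1 s := by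
  simp only [colA]; ring

/-- `colA(−u, −t) = colA(u, t)`. [folklore] -/
theorem colA_neg_neg (R : BinQF) (u t : ℝ) : colA R (-u) (-t) = colA R u t := by
  simp only [colA]; ring

/-- `colK(u, us) = colK(1, s)` for `u ≠ 0`: Tóth's weight is constant along rays. [folklore] -/
theorem colK_ray (R : BinQF) {u : ℝ} (hu : u ≠ 0) (s : ℝ) : colK R u (u * s) = colK R 1 s := by
  rw [colK, colK, show u - u * s * rootPlus R = u * (1 - s * rootPlus R) by ring,
    show u - u * s * rootMinus R = u * (1 - s * rootMinus R) by ring, mul_div_mul_left _ _ hu]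

/-- `colK(−u, −t) = colK(u, t)`. [folklore] -/
theorem colK_neg_neg (R : BinQF) (u t : ℝ) : colK R (-u) (-t) = colK R u t := by
  rw [colK, colK, show -u - -t * rootPlus R = -(u - t * rootPlus R) by ring,
    show -u - -t * rootMinus R = -(u - t * rootMinus R) by ring, neg_div_neg_eq]

/-- `ψ(u, us) = ψ(1, s)` for `u ≠ 0`. [folklore] -/
theorem colPsi_ray (R : BinQF) (L : ℝ) (m : ℤ) {u : ℝ} (hu : u ≠ 0) (s : ℝ) :
    colPsi R L m u (u * s) = colPsi R L m 1 s := by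
  rw [colPsi, colPsi, colK_ray R hu]

/-- The ray coefficient of the Hooley phase: `c_s = (B + 2Cs − b)/(2 colA(1, s))`. [cite: Ngo2024, §3.2 Lemma 3.2] -/
def rayCoef (R : BinQF) (b : ℤ) (s : ℝ) : ℝ := ((R.b : ℝ) + 2 * R.c * s - b) / (2 * colA R 1 s)

/-- `colPhi(u, us) = c_s · (u²)⁻¹` (`u ≠ 0`, `colA(1,s) ≠ 0`). [cite: Ngo2024, §3.2 Lemma 3.2] -/
theorem colPhi_ray (R : BinQF) (b : ℤ) {u : ℝ} (hu : u ≠ 0) {s : ℝ} (hr : colA R 1 s ≠ 0) :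
    colPhi R b u (u * s) = rayCoef R b s * (u ^ 2)⁻¹ := by
  rw [colPhi, colA_ray, rayCoef]
  field_simp

/-- **The column function along a ray**: for `u ≠ 0`,
`colFn(u, us) = [colA(1,s) ≠ 0] · G(u² colA(1,s)/a) · e(h c_s/u²) · ψ(1, s)`. [cite: Ngo2024, §3.5] -/
theorem colFn_ray (R : BinQF) (a b : ℤ) (x Y₁ : ℝ) (h : ℤ) (L : ℝ) (m : ℤ) {u : ℝ} (hu : u ≠ 0)
    (s : ℝ) :
    colFn R a b x Y₁ h L m u (u * s) =
      if colA R 1 s = 0 then 0 else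
        ((tothPlateau x Y₁ (u ^ 2 * colA R 1 s / a) : ℝ) : ℂ) *
          ex (h * (rayCoef R b s * (u ^ 2)⁻¹)) * ((colPsi R L m 1 s : ℝ) : ℂ) := by
  rw [colFn, colA_ray]
  by_cases hr : colA R 1 s = 0
  · rw [if_pos (by rw [hr, mul_zero]), if_pos hr]
  · rw [if_neg (mul_ne_zero (pow_ne_zero 2 hu) hr), if_neg hr, colPhi_ray R b hu hr, colPsi_ray R L m hu]

/-- **Evenness**: `colFn(−u, −t) = colFn(u, t)`. [folklore] -/
theorem colFn_neg_neg (R : BinQF) (a b : ℤ) (x Y₁ : ℝ) (h : ℤ) (L : ℝ) (m : ℤ) (u t : ℝ) :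
    colFn R a b x Y₁ h L m (-u) (-t) = colFn R a b x Y₁ h L m u t := by
  have hΦ : colPhi R b (-u) (-t) = colPhi R b u t := by
    rw [colPhi, colPhi, colA_neg_neg]
    rw [show ((R.b : ℝ) * -u + 2 * R.c * -t) = -((R.b : ℝ) * u + 2 * R.c * t) by ring,
      show (2 * -u * colA R u t) = -(2 * u * colA R u t) by ring, neg_div_neg_eq]
  rw [colFn, colFn, colA_neg_neg, hΦ, colPsi, colPsi, colK_neg_neg]

/-! ### Derivatives along a ray -/

section ray

/-- `(i+1)! ≤ (n+1)ⁱ` for `1 ≤ i ≤ n`. [folklore] -/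
theorem factorial_succ_le_pow {i n : ℕ} (hin : i ≤ n) :
    ((i + 1).factorial : ℝ) ≤ ((n : ℝ) + 1) ^ i := by
  have h1 : (i + 1).factorial ≤ (i + 1) ^ i := by
    -- `(i+1)! = ∏_{m=2}^{i+1} m ≤ (i+1)^i`
    have : ∀ k : ℕ, (k + 1).factorial ≤ (k + 1) ^ k := by
      intro k
      induction k with
      | zero => simp
      | succ k ih =>
          rw [Nat.factorial_succ, pow_succ]
          calc (k + 1 + 1) * (k + 1).factorial ≤ (k + 1 + 1) * (k + 1) ^ k :=
                Nat.mul_le_mul_left _ ih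
            _ ≤ (k + 1 + 1) * (k + 1 + 1) ^ k :=
                Nat.mul_le_mul_left _ (Nat.pow_le_pow_left (by omega) k)
            _ = (k + 1 + 1) ^ k * (k + 1 + 1) := by ring
    exact this i
  have h2 : (i + 1) ^ i ≤ (n + 1) ^ i := Nat.pow_le_pow_left (by omega) i
  exact_mod_cast h1.trans h2

/-- `|∏_{m<k} (−2 − m)| = (k+1)!`. [folklore] -/
theorem abs_prod_neg_two_sub (k : ℕ) :
    |∏ m ∈ Finset.range k, ((-2 : ℝ) - m)| = (k + 1).factorial := by
  induction k with
  | zero => simp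
  | succ k ih =>
      rw [Finset.prod_range_succ, abs_mul, ih]
      rw [show |(-2 : ℝ) - (k : ℕ)| = (k : ℝ) + 2 by
        rw [show (-2 : ℝ) - (k : ℕ) = -((k : ℝ) + 2) by ring, abs_neg,
          abs_of_nonneg (by positivity)]]
      simp only [Nat.factorial_succ, Nat.cast_mul, Nat.cast_add, Nat.cast_one]
      ring

/-- **The derivatives of `(h c) v⁻²`** at `u ≠ 0`: `‖∂ⁱ‖ ≤ |h c| (i+1)! / |u|^{i+2}`. [folklore] -/
theorem norm_iteratedDeriv_const_mul_inv_sq_le (K u : ℝ) (i : ℕ) :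
    ‖iteratedDeriv i (fun v : ℝ => K * v ^ (-2 : ℤ)) u‖ ≤ |K| * (i + 1).factorial / |u| ^ (i + 2) := by
  rw [iteratedDeriv_const_mul_field, norm_mul, Real.norm_eq_abs, iteratedDeriv_eq_iterate,
    iter_deriv_zpow (-2) u i, Real.norm_eq_abs, abs_mul]
  push_cast
  rw [abs_prod_neg_two_sub i, show ((-2 : ℤ) - (i : ℕ) : ℤ) = -((i + 2 : ℕ) : ℤ) by push_cast; ring,
    zpow_neg, zpow_natCast, abs_inv, abs_pow, mul_div_assoc, div_eq_mul_inv]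

/-- The constant of the ray derivative bound. [folklore] -/
def rayDerivConst (R : BinQF) (a b : ℤ) (n : ℕ) (Ch S MZ : ℝ) : ℝ :=
  2 ^ n * (2 ^ n * (n.factorial * MZ) * (n.factorial * MZ) * 5 ^ n) *
    (n.factorial * (2 * Real.pi) ^ n *
      (max 1 (Ch * (|(R.b : ℝ)| + 2 * |(R.c : ℝ)| * S + |(b : ℝ)|) / a) * ((n : ℝ) + 1)) ^ n)

/-- `0 ≤ rayDerivConst` for `a > 0`. [folklore] -/
theorem rayDerivConst_nonneg (R : BinQF) (a b : ℤ) (n : ℕ) (Ch S : ℝ) {MZ : ℝ}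
    (hMZ : 0 ≤ MZ) : 0 ≤ rayDerivConst R a b n Ch S MZ := by
  unfold rayDerivConst
  have : 0 ≤ max 1 (Ch * (|(R.b : ℝ)| + 2 * |(R.c : ℝ)| * S + |(b : ℝ)|) / a) :=
    le_max_of_le_left zero_le_one
  positivity

/-- `(M/r)ʲ ≤ (max 1 M)ⁿ (Y₁/r)ʲ` for `M ≥ 0`, `r > 0`, `Y₁ ≥ 1`, `j ≤ n`. [folklore] -/
theorem div_pow_le_max_pow {M r Y₁ : ℝ} (hM : 0 ≤ M) (hr : 0 < r) (hY : 1 ≤ Y₁) {j n : ℕ} (hjn : j ≤ n) :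
    (M / r) ^ j ≤ (max 1 M) ^ n * (Y₁ / r) ^ j := by
  calc (M / r) ^ j = M ^ j * (1 / r) ^ j := by rw [← mul_pow]; ring_nf
    _ ≤ (max 1 M) ^ n * (Y₁ / r) ^ j := by
        apply mul_le_mul _ _ (by positivity) (by positivity)
        · exact (pow_le_pow_left₀ hM (le_max_right _ _) j).trans
            (pow_le_pow_right₀ (le_max_left _ _) hjn)
        · exact pow_le_pow_left₀ (by positivity) (div_le_div_of_nonneg_right hY hr.le) j

/-- **The ray derivative bound at an active point**: `x > 0`, `Y₁ ≥ 1`, `|h| ≤ C_h x`, `|s| ≤ S`,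
`u ≠ 0`, `r = colA(1,s) ≠ 0` with `x/2 ≤ u² r/a ≤ 5x/2`:
`‖∂ⁿ_u colFn(u, us)‖ ≤ C (Y₁/|u|)ⁿ`. [cite: Ngo2024, §3.5 Lemma 3.17, §3.6 Lemma 3.20] -/
theorem norm_iteratedDeriv_colFn_ray_le_of_active (R : BinQF) {a : ℤ}
    (ha : 0 < a) (b : ℤ) {x Y₁ : ℝ} (hx : 0 < x) (hY1 : 1 ≤ Y₁) {h : ℤ} {Ch : ℝ} (hCh : 0 ≤ Ch)
    (hh : |(h : ℝ)| ≤ Ch * x) (L : ℝ) (m : ℤ) {S s : ℝ} (hS : |s| ≤ S) {u : ℝ} (hu : u ≠ 0)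
    (hr : colA R 1 s ≠ 0) (hlo : x / 2 ≤ u ^ 2 * colA R 1 s / a) (hhi : u ^ 2 * colA R 1 s / a ≤ 5 / 2 * x)
    {n : ℕ} {MZ : ℝ} (hMZ0 : 0 ≤ MZ)
    (hMZ : ∀ i ≤ n, ∀ s : ℝ, ‖iteratedFDeriv ℝ i Real.smoothTransition s‖ ≤ MZ) :
    ‖iteratedDeriv n (fun v => colFn R a b x Y₁ h L m v (v * s)) u‖ ≤
      rayDerivConst R a b n Ch S MZ * (Y₁ / |u|) ^ n := by
  have ha0 : (0 : ℝ) < a := by exact_mod_cast ha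
  have hu0 : 0 < |u| := abs_pos.2 hu
  have hS0 : 0 ≤ S := (abs_nonneg s).trans hS
  set r := colA R 1 s with hrdef
  have hu2 : 0 < u ^ 2 := by positivity
  -- `r > 0`, `a x/(2u²) ≤ r ≤ 5 a x/(2u²)`
  have hrlo : a * x / (2 * u ^ 2) ≤ r := by
    rw [div_le_iff₀ (by positivity)]
    rw [le_div_iff₀ ha0] at hlo
    nlinarith
  have hrhi : r ≤ 5 * (a * x) / (2 * u ^ 2) := by
    rw [le_div_iff₀ (by positivity)]
    rw [div_le_iff₀ ha0] at hhi
    nlinarith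
  have hr0 : 0 < r := lt_of_lt_of_le (by positivity) hrlo
  -- the rate and the constants
  set lam := Y₁ / |u| with hlam
  have hlam0 : 0 ≤ lam := by positivity
  set Kb : ℝ := |(R.b : ℝ)| + 2 * |(R.c : ℝ)| * S + |(b : ℝ)| with hKb
  have hKb0 : 0 ≤ Kb := by rw [hKb]; positivity
  set ME : ℝ := Ch * Kb / a with hME
  have hME0 : 0 ≤ ME := by rw [hME]; positivity
  set KP : ℝ := 2 ^ n * (n.factorial * MZ) * (n.factorial * MZ) * 5 ^ n with hKP
  set KE : ℝ := n.factorial * (2 * Real.pi) ^ n * (max 1 ME * ((n : ℝ) + 1)) ^ n with hKE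
  have hKP0 : 0 ≤ KP := by rw [hKP]; positivity
  have hKE0 : 0 ≤ KE := by rw [hKE]; positivity
  have hgoal : rayDerivConst R a b n Ch S MZ = 2 ^ n * KP * KE := by
    rw [rayDerivConst, hKP, hKE, hME, hKb]
  rw [hgoal]
  -- the representation on `{v ≠ 0}`
  set U : Set ℝ := {v : ℝ | v ≠ 0} with hU
  have hUo : IsOpen U := isOpen_compl_singleton
  have huU : u ∈ U := hu
  set c := rayCoef R b s with hc
  set P : ℝ → ℂ := fun v => ((tothPlateau x Y₁ (v ^ 2 * r / a) : ℝ) : ℂ) with hP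
  set E : ℝ → ℂ := fun v => ex (h * (c * (v ^ 2)⁻¹)) with hE
  set Ψ : ℂ := ((colPsi R L m 1 s : ℝ) : ℂ) with hΨ
  have hev : (fun v => colFn R a b x Y₁ h L m v (v * s)) =ᶠ[nhds u] fun v => Ψ * (P v * E v) := by
    filter_upwards [hUo.mem_nhds huU] with v hv
    rw [colFn_ray R a b x Y₁ h L m hv s, if_neg hr]
    ring
  rw [hev.iteratedDeriv_eq, iteratedDeriv_const_mul_field, norm_mul]
  have hΨ1 : ‖Ψ‖ ≤ 1 := by
    rw [hΨ, Complex.norm_real, Real.norm_eq_abs, abs_of_nonneg (colPsi_nonneg _ _ _ _ _)]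
    exact colPsi_le_one _ _ _ _ _
  -- (P) the plateau factor
  have hPon : ContDiffOn ℝ (⊤ : ℕ∞) P U :=
    (Complex.ofRealCLM.contDiff.comp ((contDiff_tothPlateau x Y₁).comp (by fun_prop))).contDiffOn
  have hD : |(0 : ℝ) + 2 * (r * (Y₁ / ((a : ℝ) * x))) * u| ≤ 5 * lam ∧
      2 * |r * (Y₁ / ((a : ℝ) * x))| ≤ (5 * lam) ^ 2 := by
    have hrY : r * (Y₁ / ((a : ℝ) * x)) ≤ 5 * Y₁ / (2 * u ^ 2) := by
      calc r * (Y₁ / ((a : ℝ) * x)) ≤ 5 * (a * x) / (2 * u ^ 2) * (Y₁ / ((a : ℝ) * x)) :=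
            mul_le_mul_of_nonneg_right hrhi (by positivity)
        _ = 5 * Y₁ / (2 * u ^ 2) := by field_simp
    have hpos : 0 ≤ r * (Y₁ / ((a : ℝ) * x)) := by positivity
    have hu2' : u ^ 2 = |u| ^ 2 := (sq_abs u).symm
    constructor
    · rw [zero_add, abs_mul, abs_mul, abs_two, abs_of_nonneg hpos]
      calc 2 * (r * (Y₁ / ((a : ℝ) * x))) * |u| ≤ 2 * (5 * Y₁ / (2 * u ^ 2)) * |u| := by gcongr
        _ = 5 * lam := by rw [hlam, hu2']; field_simp
    · rw [abs_of_nonneg hpos]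
      calc 2 * (r * (Y₁ / ((a : ℝ) * x))) ≤ 2 * (5 * Y₁ / (2 * u ^ 2)) := by gcongr
        _ = 5 * Y₁ / |u| ^ 2 := by rw [hu2']; field_simp
        _ ≤ (5 * lam) ^ 2 := by
            rw [hlam, show (5 * (Y₁ / |u|)) ^ 2 = (25 * Y₁ ^ 2) / |u| ^ 2 by ring]
            apply div_le_div_of_nonneg_right _ (by positivity)
            nlinarith
  have hquad : ∀ (σ : ℝ), (σ = 1 ∨ σ = -1) → ∀ (p₀ : ℝ) {i : ℕ}, 1 ≤ i →
      ‖iteratedDeriv i (fun v => p₀ + (σ * 0) * v + (σ * (r * (Y₁ / ((a : ℝ) * x)))) * v ^ 2) u‖ ≤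
        (5 * lam) ^ i := by
    intro σ hσ p₀ i hi
    have hσ1 : |σ| = 1 := by rcases hσ with rfl | rfl <;> simp
    apply norm_iteratedDeriv_quadratic_le _ _ hi
    · rw [show σ * 0 + 2 * (σ * (r * (Y₁ / ((a : ℝ) * x)))) * u = σ * (0 + 2 * (r * (Y₁ / ((a : ℝ) * x))) * u)
        by ring, abs_mul, hσ1, one_mul]
      exact hD.1
    · rw [abs_mul, hσ1, one_mul]; exact hD.2
  have hZ := norm_iteratedFDeriv_smoothTransitionC_le hMZ
  have hZ' : ∀ i ≤ n, ∀ s : ℝ, ‖iteratedDeriv i smoothTransitionC s‖ ≤ MZ := by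
    intro i hi s; rw [← norm_iteratedFDeriv_eq_norm_iteratedDeriv]; exact hZ i hi s
  have hsm : ContDiff ℝ (⊤ : ℕ∞) smoothTransitionC := contDiff_smoothTransitionC
  have hpoly : ∀ (q₀ q₁ q₂ : ℝ), ContDiff ℝ (⊤ : ℕ∞) (fun v : ℝ => q₀ + q₁ * v + q₂ * v ^ 2) := by
    intro q₀ q₁ q₂; fun_prop
  have hb : ∀ (σ : ℝ), (σ = 1 ∨ σ = -1) → ∀ q₀ : ℝ, ∀ j ≤ n,
      ‖iteratedDeriv j (fun v => smoothTransitionC (q₀ + (σ * 0) * v +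
        (σ * (r * (Y₁ / ((a : ℝ) * x)))) * v ^ 2)) u‖ ≤ (n.factorial * MZ) * (5 * lam) ^ j := by
    intro σ hσ q₀ j hj
    have h1 := norm_iteratedDeriv_comp_le_of_isOpen (g := smoothTransitionC) isOpen_univ hsm
      ((hpoly q₀ _ _).contDiffOn) (Set.mem_univ u) (n := j) (C := MZ) (D := 5 * lam)
      (fun i hi s => hZ' i (hi.trans hj) s) (fun i hi1 _ => hquad σ hσ q₀ hi1)
    refine h1.trans ?_
    have : (j.factorial : ℝ) ≤ n.factorial := by exact_mod_cast Nat.factorial_le hj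
    exact mul_le_mul_of_nonneg_right (mul_le_mul_of_nonneg_right this hMZ0) (by positivity)
  have hPfun : P = fun v => smoothTransitionC (((-(x - x / Y₁)) * (Y₁ / x)) + (1 * 0) * v +
      (1 * (r * (Y₁ / ((a : ℝ) * x)))) * v ^ 2) *
      smoothTransitionC (((2 * x + x / Y₁) * (Y₁ / x)) + ((-1) * 0) * v +
        ((-1) * (r * (Y₁ / ((a : ℝ) * x)))) * v ^ 2) := by
    funext v
    simp only [hP, tothPlateau, smoothTransitionC, Complex.ofReal_mul]
    congr 2
    · ring
    · ring
  set q₁ : ℝ → ℝ := fun v => ((-(x - x / Y₁)) * (Y₁ / x)) + (1 * 0) * v +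
      (1 * (r * (Y₁ / ((a : ℝ) * x)))) * v ^ 2 with hq₁
  set q₂ : ℝ → ℝ := fun v => ((2 * x + x / Y₁) * (Y₁ / x)) + ((-1) * 0) * v +
        ((-1) * (r * (Y₁ / ((a : ℝ) * x)))) * v ^ 2 with hq₂
  have hF1 : ∀ j ≤ n, ‖iteratedDeriv j P u‖ ≤ KP * lam ^ j := by
    intro j hj
    rw [hPfun]
    have h1 := norm_iteratedDeriv_mul_le_of_isOpen (f := fun v => smoothTransitionC (q₁ v))
      (g := fun v => smoothTransitionC (q₂ v)) isOpen_univ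
      ((hsm.comp (hpoly _ _ _)).contDiffOn) ((hsm.comp (hpoly _ _ _)).contDiffOn) (Set.mem_univ u)
      (n := j) (Kf := n.factorial * MZ) (Kg := n.factorial * MZ) (lam := 5 * lam) (by positivity)
      (by positivity) (fun i hi => hb 1 (Or.inl rfl) _ i (hi.trans hj))
      (fun i hi => hb (-1) (Or.inr rfl) _ i (hi.trans hj))
    refine h1.trans ?_
    rw [hKP, mul_pow]
    have e1 : (2 : ℝ) ^ j ≤ 2 ^ n := pow_le_pow_right₀ (by norm_num) hj
    have e2 : (5 : ℝ) ^ j ≤ 5 ^ n := pow_le_pow_right₀ (by norm_num) hj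
    have : (2 : ℝ) ^ j * (n.factorial * MZ) * (n.factorial * MZ) * 5 ^ j ≤
        2 ^ n * (n.factorial * MZ) * (n.factorial * MZ) * 5 ^ n :=
      mul_le_mul (mul_le_mul_of_nonneg_right (mul_le_mul_of_nonneg_right e1 (by positivity))
        (by positivity)) e2 (by positivity) (by positivity)
    calc (2 : ℝ) ^ j * (n.factorial * MZ) * (n.factorial * MZ) * (5 ^ j * lam ^ j)
        = (2 : ℝ) ^ j * (n.factorial * MZ) * (n.factorial * MZ) * 5 ^ j * lam ^ j := by ring
      _ ≤ _ := mul_le_mul_of_nonneg_right this (by positivity)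
  -- (E) the phase factor
  have hgfun : (fun v : ℝ => (h : ℝ) * (c * (v ^ 2)⁻¹)) = fun v => ((h : ℝ) * c) * v ^ (-2 : ℤ) := by
    funext v
    rw [show (-2 : ℤ) = -((2 : ℕ) : ℤ) by norm_num, zpow_neg, zpow_natCast]
    ring
  have hgon : ContDiffOn ℝ (⊤ : ℕ∞) (fun v : ℝ => (h : ℝ) * (c * (v ^ 2)⁻¹)) U := by
    intro v hv
    exact (contDiffAt_const.mul (contDiffAt_const.mul ((contDiffAt_id.pow 2).inv
      (pow_ne_zero 2 hv)))).contDiffWithinAt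
  have hEon : ContDiffOn ℝ (⊤ : ℕ∞) E U := contDiff_ex.comp_contDiffOn hgon
  have hhc : |(h : ℝ) * c| / u ^ 2 ≤ ME := by
    rw [abs_mul, hc, rayCoef, ← hrdef, abs_div, abs_mul, abs_two, abs_of_pos hr0]
    have h2r : 1 / (2 * r) ≤ u ^ 2 / ((a : ℝ) * x) := by
      rw [div_le_div_iff₀ (by positivity) (by positivity), one_mul]
      rw [div_le_iff₀ (by positivity)] at hrlo
      linarith
    have hnum : |(R.b : ℝ) + 2 * R.c * s - b| ≤ Kb := by
      rw [hKb]
      calc |(R.b : ℝ) + 2 * R.c * s - b| ≤ |(R.b : ℝ) + 2 * R.c * s| + |(b : ℝ)| := abs_sub _ _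
        _ ≤ |(R.b : ℝ)| + |2 * (R.c : ℝ) * s| + |(b : ℝ)| := by linarith [abs_add_le (R.b : ℝ) (2 * R.c * s)]
        _ = |(R.b : ℝ)| + 2 * |(R.c : ℝ)| * |s| + |(b : ℝ)| := by rw [abs_mul, abs_mul, abs_two]
        _ ≤ _ := by gcongr
    have hstep : |(R.b : ℝ) + 2 * R.c * s - b| / (2 * r) ≤ Kb * (u ^ 2 / ((a : ℝ) * x)) := by
      rw [div_eq_mul_one_div]
      exact mul_le_mul hnum h2r (by positivity) hKb0
    have hnum2 : |(h : ℝ)| * (|(R.b : ℝ) + 2 * R.c * s - b| / (2 * r)) ≤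
        (Ch * x) * (Kb * (u ^ 2 / ((a : ℝ) * x))) :=
      mul_le_mul hh hstep (by positivity) (by positivity)
    calc |(h : ℝ)| * (|(R.b : ℝ) + 2 * R.c * s - b| / (2 * r)) / u ^ 2
        ≤ (Ch * x) * (Kb * (u ^ 2 / ((a : ℝ) * x))) / u ^ 2 := div_le_div_of_nonneg_right hnum2 hu2.le
      _ = ME := by rw [hME]; field_simp
  have hgD : ∀ i, 1 ≤ i → i ≤ n →
      ‖iteratedDeriv i (fun v : ℝ => (h : ℝ) * (c * (v ^ 2)⁻¹)) u‖ ≤ (max 1 ME * ((n : ℝ) + 1) / |u|) ^ i := by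
    intro i hi1 hin
    rw [hgfun]
    refine (norm_iteratedDeriv_const_mul_inv_sq_le _ u i).trans ?_
    have hfac := factorial_succ_le_pow hin
    have hmax : ME ≤ (max 1 ME) ^ i := by
      calc ME ≤ max 1 ME := le_max_right _ _
        _ = (max 1 ME) ^ 1 := (pow_one _).symm
        _ ≤ (max 1 ME) ^ i := pow_le_pow_right₀ (le_max_left _ _) hi1
    calc |(h : ℝ) * c| * ((i + 1).factorial : ℝ) / |u| ^ (i + 2)
        = (|(h : ℝ) * c| / u ^ 2) * (((i + 1).factorial : ℝ) / |u| ^ i) := by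
          rw [div_mul_div_comm, ← sq_abs, ← pow_add, show 2 + i = i + 2 from add_comm 2 i]
      _ ≤ (max 1 ME) ^ i * (((n : ℝ) + 1) ^ i / |u| ^ i) := by
          refine mul_le_mul (hhc.trans hmax) (div_le_div_of_nonneg_right hfac (by positivity))
            (by positivity) (by positivity)
      _ = (max 1 ME * ((n : ℝ) + 1) / |u|) ^ i := by rw [div_pow, mul_pow]; ring
  have hF2 : ∀ j ≤ n, ‖iteratedDeriv j E u‖ ≤ KE * lam ^ j := by
    intro j hj
    have h1 := norm_iteratedDeriv_ex_comp_le hUo hgon huU (n := j)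
      (D := max 1 ME * ((n : ℝ) + 1) / |u|) (fun i hi1 hij => hgD i hi1 (hij.trans hj))
    refine h1.trans ?_
    have e1 : (j.factorial : ℝ) * (2 * Real.pi) ^ j ≤ n.factorial * (2 * Real.pi) ^ n :=
      mul_le_mul (by exact_mod_cast Nat.factorial_le hj)
        (pow_le_pow_right₀ (by linarith [Real.pi_gt_three]) hj) (by positivity) (by positivity)
    have e2 := div_pow_le_max_pow (M := max 1 ME * ((n : ℝ) + 1)) (by positivity) hu0 hY1 hj (n := n)
    have hmm : max 1 (max 1 ME * ((n : ℝ) + 1)) = max 1 ME * ((n : ℝ) + 1) := by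
      apply max_eq_right
      have h1 : (1 : ℝ) ≤ max 1 ME := le_max_left _ _
      have h2 : (1 : ℝ) ≤ (n : ℝ) + 1 := by have := (Nat.cast_nonneg n : (0 : ℝ) ≤ n); linarith
      exact one_le_mul_of_one_le_of_one_le h1 h2
    rw [hmm] at e2
    rw [hKE]
    calc (j.factorial : ℝ) * (2 * Real.pi) ^ j * (max 1 ME * ((n : ℝ) + 1) / |u|) ^ j
        ≤ (n.factorial * (2 * Real.pi) ^ n) * ((max 1 ME * ((n : ℝ) + 1)) ^ n * (Y₁ / |u|) ^ j) :=
          mul_le_mul e1 e2 (by positivity) (by positivity)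
      _ = _ := by rw [hlam]; ring
  -- Leibniz
  have h2 := norm_iteratedDeriv_mul_le_of_isOpen hUo hPon hEon huU (n := n) hKP0 hlam0 hF1 hF2
  calc ‖Ψ‖ * ‖iteratedDeriv n (fun v => P v * E v) u‖ ≤ 1 * (2 ^ n * KP * KE * lam ^ n) :=
        mul_le_mul hΨ1 h2 (norm_nonneg _) zero_le_one
    _ = _ := by ring

/-- **The ray derivative bound, all `u ≠ 0`**: for every `n` there is `A` (depending on
`R, a, b, n, C_h, S` only) with `‖∂ⁿ_u colFn(u, us)‖ ≤ A (Y₁/|u|)ⁿ` for `x > 0`, `Y₁ ≥ 2`,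
`|h| ≤ C_h x`, `|s| ≤ S`, `u ≠ 0` (for any shift `m` and `L`).  Inactive rays or scales carry the
zero function near `u`. [cite: Ngo2024, §3.5 Lemma 3.17, §3.6 Lemma 3.20] -/
theorem exists_norm_iteratedDeriv_colFn_ray_le (R : BinQF) {a : ℤ} (ha : 0 < a)
    (b : ℤ) (L : ℝ) (m : ℤ) (n : ℕ) {Ch S : ℝ} (hCh : 0 ≤ Ch) :
    ∃ A : ℝ, 0 ≤ A ∧ ∀ (x Y₁ : ℝ) (h : ℤ) (s u : ℝ), 0 < x → 2 ≤ Y₁ → |(h : ℝ)| ≤ Ch * x →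
      |s| ≤ S → u ≠ 0 →
        ‖iteratedDeriv n (fun v => colFn R a b x Y₁ h L m v (v * s)) u‖ ≤ A * (Y₁ / |u|) ^ n := by
  obtain ⟨MZ, hMZ1, hMZ⟩ := exists_bound_iteratedFDeriv_smoothTransition n
  have hMZ0 : 0 ≤ MZ := zero_le_one.trans hMZ1
  refine ⟨rayDerivConst R a b n Ch S MZ, rayDerivConst_nonneg R a b n Ch S hMZ0, ?_⟩
  intro x Y₁ h s u hx hY hh hs hu
  have hY1 : 1 ≤ Y₁ := by linarith
  have ha0 : (0 : ℝ) < a := by exact_mod_cast ha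
  have hC0 := rayDerivConst_nonneg R a b n Ch S hMZ0
  have hzero : (fun v => colFn R a b x Y₁ h L m v (v * s)) =ᶠ[nhds u] (fun _ => (0 : ℂ)) →
      ‖iteratedDeriv n (fun v => colFn R a b x Y₁ h L m v (v * s)) u‖ ≤
        rayDerivConst R a b n Ch S MZ * (Y₁ / |u|) ^ n := by
    intro hev
    rw [hev.iteratedDeriv_eq, iteratedDeriv_const]
    split_ifs <;> simp <;> positivity
  have hUo : IsOpen {v : ℝ | v ≠ 0} := isOpen_compl_singleton
  by_cases hr : colA R 1 s = 0
  · apply hzero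
    filter_upwards [hUo.mem_nhds hu] with v hv
    rw [colFn_ray R a b x Y₁ h L m hv s, if_pos hr]
  -- the plateau along the ray vanishes unless `x/2 < v² r/a < 5x/2`
  have hvan : ∀ v : ℝ, v ≠ 0 → ¬ (x / 2 < v ^ 2 * colA R 1 s / a ∧ v ^ 2 * colA R 1 s / a < 5 / 2 * x) →
      colFn R a b x Y₁ h L m v (v * s) = 0 := by
    intro v hv hnot
    rw [colFn_ray R a b x Y₁ h L m hv s, if_neg hr]
    by_cases hG : tothPlateau x Y₁ (v ^ 2 * colA R 1 s / a) = 0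
    · rw [hG]; simp
    · exact absurd (tothPlateau_support' hx hY hG) hnot
  have hcont : Continuous fun v : ℝ => v ^ 2 * colA R 1 s / a := by fun_prop
  by_cases hlo : x / 2 ≤ u ^ 2 * colA R 1 s / a
  · by_cases hhi : u ^ 2 * colA R 1 s / a ≤ 5 / 2 * x
    · exact norm_iteratedDeriv_colFn_ray_le_of_active R ha b hx hY1 hCh hh L m hs hu hr hlo hhi
        hMZ0 hMZ
    · apply hzero
      have hev : ∀ᶠ v in nhds u, 5 / 2 * x < v ^ 2 * colA R 1 s / a :=
        hcont.continuousAt.eventually_const_lt (not_le.1 hhi)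
      filter_upwards [hev, hUo.mem_nhds hu] with v hv hv0
      exact hvan v hv0 fun hh' => by linarith [hh'.2]
  · apply hzero
    have hev : ∀ᶠ v in nhds u, v ^ 2 * colA R 1 s / a < x / 2 :=
      hcont.continuousAt.eventually_lt_const (not_le.1 hlo)
    filter_upwards [hev, hUo.mem_nhds hu] with v hv hv0
    exact hvan v hv0 fun hh' => by linarith [hh'.1]

end ray

/-! ### The Fourier transform of a column along rays -/

section fourier

/-- `colFn(α, αs) = colFn(|α|, |α| s)` (evenness). [folklore] -/
theorem colFn_intCast_mul (R : BinQF) (a b : ℤ) (x Y₁ : ℝ) (h : ℤ) (L : ℝ) (m : ℤ) (α : ℤ) (s : ℝ) :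
    colFn R a b x Y₁ h L m α ((α : ℝ) * s) = colFn R a b x Y₁ h L m α.natAbs ((α.natAbs : ℝ) * s) := by
  rcases le_or_gt 0 α with hα | hα
  · rw [natCast_natAbs_real, ← Int.cast_abs, abs_of_nonneg hα]
  · rw [natCast_natAbs_real, ← Int.cast_abs, abs_of_neg hα, Int.cast_neg, neg_mul,
      ← colFn_neg_neg R a b x Y₁ h L m (-(α : ℝ)), neg_neg, neg_neg]

/-- `σ n s (κ/(n q)) = σ s κ / q` for `n ≠ 0` (also when `q = 0`). [folklore] -/
theorem ray_phase_aux (σ n s κ q : ℝ) (hn : n ≠ 0) :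
    σ * n * s * (κ / (n * q)) = σ * s * κ / q := by
  rcases eq_or_ne q 0 with hq | hq
  · simp [hq]
  · rw [mul_div_assoc', div_eq_div_iff (mul_ne_zero hn hq) hq]; ring

/-- **The Fourier transform of a column along rays**: for `α ≠ 0`, `M_α = |α| a d`,
`𝓕(colFn(α,·))(κ/M_α) = |α| ∫ e(−sgn(α) s κ/(ad)) colFn(|α|, |α| s) ds` (the substitution
`t = αs` in `𝓕f(w) = ∫ e(−tw) f(t) dt`, and evenness). In these coordinates the dependence on the
modulus `|α|` and on the frequency `κ` is a product. [cite: Ngo2024, §3.5 Lemma 3.15, Proposition 3.18 (proof)] -/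
theorem fourier_colFn_eq_ray (R : BinQF) (a b : ℤ) (x Y₁ : ℝ) (h : ℤ) (L : ℝ) (m : ℤ) {α : ℤ}
    (hα : α ≠ 0) (d : ℕ) (κ : ℤ) :
    𝓕 (fun t => colFn R a b x Y₁ h L m α t) ((κ : ℝ) / ((α.natAbs * (a.toNat * d) : ℕ) : ℝ)) =
      (α.natAbs : ℂ) * ∫ s : ℝ, (𝐞 (-((α.sign : ℝ) * s * κ / ((a.toNat * d : ℕ) : ℝ))) : ℂ) *
        colFn R a b x Y₁ h L m α.natAbs ((α.natAbs : ℝ) * s) := by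
  rw [Real.fourier_real_eq]
  set w : ℝ := (κ : ℝ) / ((α.natAbs * (a.toNat * d) : ℕ) : ℝ) with hw
  set g : ℝ → ℂ := fun v => 𝐞 (-(v * w)) • colFn R a b x Y₁ h L m α v with hg
  have hαr : (α : ℝ) ≠ 0 := by exact_mod_cast hα
  have hsub : ∫ v, g v = |(α : ℝ)| • ∫ s, g ((α : ℝ) * s) := by
    rw [MeasureTheory.Measure.integral_comp_mul_left g (α : ℝ), smul_smul, abs_inv,
      mul_inv_cancel₀ (abs_ne_zero.2 hαr), one_smul]
  change ∫ v, g v = _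
  have hlead : ((α.natAbs : ℕ) : ℂ) = ((|(α : ℝ)| : ℝ) : ℂ) := by
    rw [← natCast_natAbs_real, Complex.ofReal_natCast]
  rw [hsub, Complex.real_smul, hlead]
  congr 1
  refine integral_congr_ae (Filter.Eventually.of_forall fun s => ?_)
  have hn : ((α.natAbs : ℕ) : ℝ) ≠ 0 := by
    rw [natCast_natAbs_real]; exact abs_ne_zero.2 hαr
  have hsgn : (α : ℝ) = (α.sign : ℝ) * (α.natAbs : ℕ) := by
    rw [natCast_natAbs_real, ← Int.cast_abs, ← Int.cast_mul, Int.sign_mul_abs]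
  have harg : -(((α : ℝ) * s) * w) = -((α.sign : ℝ) * s * κ / ((a.toNat * d : ℕ) : ℝ)) := by
    rw [hw, neg_inj, hsgn, Nat.cast_mul]
    exact ray_phase_aux _ _ _ _ _ hn
  simp only [hg, Circle.smul_def, smul_eq_mul]
  rw [harg, colFn_intCast_mul R a b x Y₁ h L m α s]

end fourier

/-! ### Symmetries of the complete sums -/

section symmetry

variable {a : ℤ}

/-- `conj e(x) = e(−x)`. [folklore] -/
theorem conj_ex (y : ℝ) : starRingEnd ℂ (ex y) = ex (-y) := by
  have h : ∀ t : ℝ, ex t = Complex.exp (((2 * Real.pi * t : ℝ) : ℂ) * Complex.I) := fun t => by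
    rw [ex]; congr 1; push_cast; ring
  rw [h, h, ← Complex.exp_conj, map_mul, Complex.conj_ofReal, Complex.conj_I]
  congr 1; push_cast; ring

/-- `conj colCoef(h) = colCoef(−h)`. [folklore] -/
theorem conj_colCoef (a : ℤ) (d : ℕ) (R : BinQF) (h α γ : ℤ) :
    starRingEnd ℂ (colCoef a d R h α γ) = colCoef a d R (-h) α γ := by
  unfold colCoef
  split_ifs
  · rw [conj_ex]; congr 1; push_cast; ring
  · exact map_zero _

/-- **`conj S_α(h, κ) = S_α(−h, −κ)`.** [folklore] -/
theorem conj_colExpSum (a : ℤ) (d : ℕ) (R : BinQF) (h α κ : ℤ) :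
    starRingEnd ℂ (colExpSum a d R h α κ) = colExpSum a d R (-h) α (-κ) := by
  unfold colExpSum
  rw [map_sum]
  refine Finset.sum_congr rfl fun r _ => ?_
  -- `conj 𝐞(y) = 𝐞(−y)` (the tree's `BFI.conj_e`, inlined)
  have conj_fc : ∀ y : ℝ, starRingEnd ℂ (𝐞 y : ℂ) = (𝐞 (-y) : ℂ) := fun y => by
    rw [← Circle.coe_inv_eq_conj, AddChar.map_neg_eq_inv]
  rw [map_mul, conj_colCoef, conj_fc]
  congr 2
  push_cast; ring

/-- `gcd(−α, −γ) = gcd(α, γ)`. [folklore] -/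
theorem int_gcd_neg_neg (α γ : ℤ) : Int.gcd (-α) (-γ) = Int.gcd α γ := by
  rw [Int.gcd_eq_natAbs, Int.gcd_eq_natAbs, Int.natAbs_neg, Int.natAbs_neg]

/-- The Bezout inverses of `(α, γ)` and `(−α, −γ)` agree up to sign mod `α`. [folklore] -/
theorem gcdB_neg_neg_modEq {α γ : ℤ} (hg : Int.gcd α γ = 1) :
    -Int.gcdB (-α) (-γ) ≡ Int.gcdB α γ [ZMOD α] := by
  have hg' : Int.gcd (-α) (-γ) = 1 := by rw [int_gcd_neg_neg, hg]
  have h1 := col_mul_gcdB_modEq α γ hg              -- γ·B ≡ 1 [α]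
  have h2 := col_mul_gcdB_modEq (-α) (-γ) hg'      -- (−γ)·B' ≡ 1 [−α]
  rw [Int.modEq_neg] at h2
  -- `γ · (−B') ≡ 1 [α]`, so `−B' ≡ B γ (−B') ≡ B`
  have h3 : γ * (-Int.gcdB (-α) (-γ)) ≡ 1 [ZMOD α] := by
    rw [show γ * (-Int.gcdB (-α) (-γ)) = -γ * Int.gcdB (-α) (-γ) by ring]; exact h2
  have h4 : Int.gcdB α γ * (γ * (-Int.gcdB (-α) (-γ))) ≡ Int.gcdB α γ * 1 [ZMOD α] := h3.mul_left _
  have h5 : (γ * Int.gcdB α γ) * (-Int.gcdB (-α) (-γ)) ≡ 1 * (-Int.gcdB (-α) (-γ)) [ZMOD α] :=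
    h1.mul_right _
  rw [one_mul] at h5
  rw [mul_one] at h4
  calc -Int.gcdB (-α) (-γ) ≡ (γ * Int.gcdB α γ) * (-Int.gcdB (-α) (-γ)) [ZMOD α] := h5.symm
    _ = Int.gcdB α γ * (γ * (-Int.gcdB (-α) (-γ))) := by ring
    _ ≡ Int.gcdB α γ [ZMOD α] := h4

/-- **`colCoef(−α, −γ) = colCoef(α, γ)`** (the conditions are even; the phases `e(−h B'/(−α))`,
`e(−h B/α)` agree since `−B' ≡ B (mod α)`). [folklore] -/
theorem colCoef_neg_neg (a : ℤ) (d : ℕ) (R : BinQF) (h : ℤ) {α : ℤ} (hα : α ≠ 0) (γ : ℤ) :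
    colCoef a d R h (-α) (-γ) = colCoef a d R h α γ := by
  unfold colCoef
  have e1 : Int.gcd (-α) (-γ) = Int.gcd α γ := int_gcd_neg_neg α γ
  have e2 : (a ∣ -γ) ↔ (a ∣ γ) := dvd_neg
  have e3 : R.eval (-α) (-γ) = R.eval α γ := by simp only [BinQF.eval]; ring
  rw [e1, e3]
  simp only [e2]
  split_ifs with hc
  · -- the phases
    have hph : ex (h * ((-Int.gcdB (-α) (-γ) : ℤ) : ℝ) / (-α : ℤ)) =
        ex (h * ((-(-Int.gcdB (-α) (-γ)) : ℤ) : ℝ) / α) := by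
      congr 1; push_cast; ring
    rw [hph]
    exact ex_div_congr hα h ((gcdB_neg_neg_modEq hc.1).neg.symm.symm |> fun h' => by
      have := (gcdB_neg_neg_modEq hc.1)
      -- `−(−B') = B'`... we need `-(-B') ≡ -B [α]`, i.e. `B' ≡ -B`
      have h'' : -(-Int.gcdB (-α) (-γ)) ≡ -Int.gcdB α γ [ZMOD α] := this.neg
      exact h'')
  · rfl

/-- `colCoef` only depends on `γ mod M_α`. [folklore] -/
theorem colCoef_eq_of_modEq (ha : 0 < a) (d : ℕ) (R : BinQF) (h : ℤ) {α : ℤ} (hα : α ≠ 0)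
    {γ γ' : ℤ} (hγ : γ ≡ γ' [ZMOD ((α.natAbs * (a.toNat * d) : ℕ) : ℤ)]) :
    colCoef a d R h α γ = colCoef a d R h α γ' := by
  obtain ⟨q, hq⟩ := Int.modEq_iff_dvd.1 hγ.symm
  have : γ = γ' + ((α.natAbs * (a.toNat * d) : ℕ) : ℤ) * q := by linear_combination hq
  rw [this, colCoef_add_mul_period ha d R h hα]

/-- Sums over `Fin M` as sums over `ZMod M` (`M ≠ 0`). [folklore] -/
theorem sum_fin_eq_sum_zmod {M : ℕ} [NeZero M] (F : ℕ → ℂ) :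
    ∑ r : Fin M, F r = ∑ r : ZMod M, F r.val := by
  obtain ⟨M', rfl⟩ : ∃ M', M = M' + 1 := ⟨M - 1, by have := NeZero.pos M; omega⟩
  rfl

/-- **`S_{−α}(h, κ) = S_α(h, −κ)`** (`colCoef(−α, r) = colCoef(α, −r)` and `r ↦ −r` mod `M_α`).
[folklore] -/
theorem colExpSum_neg_left (ha : 0 < a) (d : ℕ) (R : BinQF) (h : ℤ) {α : ℤ} (hα : α ≠ 0) (κ : ℤ) :
    colExpSum a d R h (-α) κ = colExpSum a d R h α (-κ) := by
  unfold colExpSum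
  rw [Int.natAbs_neg]
  set M : ℕ := α.natAbs * (a.toNat * d) with hM
  rcases Nat.eq_zero_or_pos M with hM0 | hMpos
  · -- empty sums
    have : IsEmpty (Fin M) := by rw [hM0]; infer_instance
    rw [Finset.univ_eq_empty, Finset.sum_empty, Finset.sum_empty]
  haveI : NeZero M := ⟨hMpos.ne'⟩
  -- pass to `ZMod M` and reindex the left-hand sum by negation
  have e1 : ∑ r : Fin M, colCoef a d R h (-α) r * (𝐞 ((r : ℝ) * κ / (M : ℝ)) : ℂ) =
      ∑ r : ZMod M, colCoef a d R h (-α) r.val * (𝐞 ((r.val : ℝ) * κ / (M : ℝ)) : ℂ) :=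
    sum_fin_eq_sum_zmod (fun r => colCoef a d R h (-α) r * (𝐞 ((r : ℝ) * κ / (M : ℝ)) : ℂ))
  have e2 : ∑ r : Fin M, colCoef a d R h α r * (𝐞 ((r : ℝ) * ((-κ : ℤ) : ℝ) / (M : ℝ)) : ℂ) =
      ∑ r : ZMod M, colCoef a d R h α r.val * (𝐞 ((r.val : ℝ) * ((-κ : ℤ) : ℝ) / (M : ℝ)) : ℂ) :=
    sum_fin_eq_sum_zmod (fun r => colCoef a d R h α r * (𝐞 ((r : ℝ) * ((-κ : ℤ) : ℝ) / (M : ℝ)) : ℂ))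
  rw [e1, e2, ← Equiv.sum_comp (Equiv.neg (ZMod M))
    (fun r : ZMod M => colCoef a d R h (-α) r.val * (𝐞 ((r.val : ℝ) * κ / (M : ℝ)) : ℂ))]
  refine Finset.sum_congr rfl fun r _ => ?_
  simp only [Equiv.neg_apply]
  -- the coefficients
  have hcoef : colCoef a d R h (-α) (((-r).val : ℕ) : ℤ) = colCoef a d R h α ((r.val : ℕ) : ℤ) := by
    rw [show (((-r).val : ℕ) : ℤ) = -(-(((-r).val : ℕ) : ℤ)) by ring, colCoef_neg_neg a d R h hα]
    refine colCoef_eq_of_modEq ha d R h hα ?_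
    rw [← hM, ← ZMod.intCast_eq_intCast_iff]
    push_cast
    rw [ZMod.natCast_zmod_val, ZMod.natCast_zmod_val, neg_neg]
  -- the characters: `𝐞(j/M) = ψ_M(j)` (Mathlib's `ZMod.stdAddChar_coe`; cf. the tree's
  -- `MontgomeryVaughan1975.fourierChar_div_eq_stdAddChar'`, inlined here)
  have fc_div : ∀ j : ℤ, (𝐞 ((j : ℝ) / M) : ℂ) = ZMod.stdAddChar ((j : ℤ) : ZMod M) := fun j => by
    rw [ZMod.stdAddChar_coe, Real.fourierChar_apply]
    congr 1
    push_cast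
    ring
  have hchar : (𝐞 ((((-r).val : ℕ) : ℝ) * κ / (M : ℝ)) : ℂ) =
      (𝐞 (((r.val : ℕ) : ℝ) * ((-κ : ℤ) : ℝ) / (M : ℝ)) : ℂ) := by
    rw [show (((-r).val : ℕ) : ℝ) * κ = ((((-r).val : ℕ) * κ : ℤ) : ℝ) by push_cast; ring,
      show ((r.val : ℕ) : ℝ) * ((-κ : ℤ) : ℝ) = (((r.val : ℕ) * (-κ) : ℤ) : ℝ) by push_cast; ring,
      fc_div, fc_div]
    congr 1
    push_cast
    rw [ZMod.natCast_zmod_val, ZMod.natCast_zmod_val]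
    ring
  rw [hcoef, hchar]

end symmetry

end RootForms

end Literature.NumberTheory.Sieve

/-!
## Part 3. Dyadic partitions of unity and the sign symmetries of the dual Tóth sums

Topic `Literature/NumberTheory/Sieve`, continuation of Part 2.  T. Ngo's
Theorem 2.5 (arXiv:2107.13301; Pitt's bound for sums of Kloosterman sums) is stated for a smooth
weight `V(c, κ)` supported in a dyadic box `C < c < 2C`, `K < κ < 2K`, with positive moduli `c` and
positive frequencies `κ`.  To bring the Poisson-dual Tóth sums
`∑_{0<|α|≤A} M_α⁻¹ ∑_κ 𝓕(colFn(α,·))(κ/M_α) S_α(h,κ)` (`…TothColumnSum.tothSum_eq_dualSum`) into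
this shape one needs (Ngo, proof of Proposition 3.18, "dyadic partitions" being implicit there):

* a smooth **dyadic partition of unity** on `(0, ∞)`: `dyadic ℓ v = β(2 log₂ v − ℓ)` (`β` the unit
  partition of `…TothWeylSum`), supported in `(K_ℓ, 2K_ℓ)`, `K_ℓ = 2^{ℓ/2}` (`dyadic_support`),
  `∑_ℓ dyadic ℓ v = 1` (`tsum_dyadic`, `sum_dyadic_eq_one`), smooth on `ℝ` (`contDiff_dyadic`) with
  `‖∂ʲ dyadic ℓ (v)‖ ≤ j! M (c_n/v)ʲ` (`norm_iteratedDeriv_dyadic_le`);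
* the **sign symmetries** of the dual terms `F_α^{[h]}(κ) = 𝓕(colFn^{[h]}(α,·))(κ/M_α) S_α(h,κ)`:
  `conj colFn^{[h]} = colFn^{[−h]}` (`conj_colFn`), `conj 𝓕f(w) = 𝓕(conj ∘ f)(−w)` (`conj_fourier`),
  hence `F_α^{[h]}(−κ) = conj F_α^{[−h]}(κ)` (`dualTerm_neg_right`); and
  `𝓕(colFn(−α,·))(w) = 𝓕(colFn(α,·))(−w)` (`fourier_colFn_neg_left`), which with
  `S_{−α}(h,κ) = S_α(h,−κ)` gives the evenness in `α` of the weighted column sums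
  (`dualCol_neg`) and `∑_{0<|α|≤A} = 2 ∑_{1≤α≤A}` (`sum_Icc_erase_zero_eq`).

## References

* T. Ngo, *On roots of quadratic congruences*, arXiv:2107.13301 (Bull. LMS 2024), §2.2 Theorem 2.5,
  §3.5 Proposition 3.18. [cite: Ngo2024, §2.2 Theorem 2.5, §3.5 Proposition 3.18]
* Á. Tóth, *Roots of quadratic congruences*, IMRN 2000, 719–739. [cite: Toth2000, §4]
-/

noncomputable section

namespace Literature.NumberTheory.Sieve

open scoped MatrixGroups ContDiff FourierTransform ComplexConjugate
open Literature.NumberTheory.QuadraticFields.Quadratic (BinQF)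
open Real Finset MeasureTheory

namespace RootForms

/-! ### The dyadic scales `K_ℓ = 2^{ℓ/2}` -/

/-- The dyadic scale `K_ℓ = 2^{ℓ/2}` (half-integer powers of `2`, so that consecutive supports
`(K_ℓ, 2K_ℓ)` overlap). [folklore] -/
def dyScale (ℓ : ℤ) : ℝ := (2 : ℝ) ^ ((ℓ : ℝ) / 2)

/-- `K_ℓ > 0`. [folklore] -/
theorem dyScale_pos (ℓ : ℤ) : 0 < dyScale ℓ := Real.rpow_pos_of_pos two_pos _

/-- `K_{ℓ+2} = 2 K_ℓ`. [folklore] -/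
theorem dyScale_add_two (ℓ : ℤ) : dyScale (ℓ + 2) = 2 * dyScale ℓ := by
  unfold dyScale
  rw [show (((ℓ + 2 : ℤ) : ℝ) / 2) = (ℓ : ℝ) / 2 + 1 by push_cast; ring,
    Real.rpow_add two_pos, Real.rpow_one, mul_comm]

/-- `K_{ℓ+1} ≤ 2 K_ℓ` (`√2 ≤ 2`). [folklore] -/
theorem dyScale_add_one_le (ℓ : ℤ) : dyScale (ℓ + 1) ≤ 2 * dyScale ℓ := by
  unfold dyScale
  rw [show (((ℓ + 1 : ℤ) : ℝ) / 2) = (ℓ : ℝ) / 2 + 1 / 2 by push_cast; ring,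
    Real.rpow_add two_pos, mul_comm]
  refine mul_le_mul_of_nonneg_right ?_ (Real.rpow_nonneg zero_le_two _)
  calc (2 : ℝ) ^ (1 / 2 : ℝ) ≤ (2 : ℝ) ^ (1 : ℝ) :=
        Real.rpow_le_rpow_of_exponent_le one_le_two (by norm_num)
    _ = 2 := Real.rpow_one 2

/-- `log K_ℓ = (ℓ/2) log 2`. [folklore] -/
theorem log_dyScale (ℓ : ℤ) : Real.log (dyScale ℓ) = (ℓ : ℝ) / 2 * Real.log 2 := by
  unfold dyScale; rw [Real.log_rpow two_pos]

/-- `K_ℓ` is monotone in `ℓ`. [folklore] -/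
theorem dyScale_mono {ℓ ℓ' : ℤ} (h : ℓ ≤ ℓ') : dyScale ℓ ≤ dyScale ℓ' := by
  unfold dyScale
  refine Real.rpow_le_rpow_of_exponent_le one_le_two ?_
  have : (ℓ : ℝ) ≤ ℓ' := by exact_mod_cast h
  linarith

/-- `K_{−2} = 1/2`. [folklore] -/
theorem dyScale_neg_two : dyScale (-2) = 1 / 2 := by
  unfold dyScale
  rw [show (((-2 : ℤ) : ℝ) / 2) = -1 by norm_num, Real.rpow_neg_one]; norm_num

/-- `K_0 = 1`. [folklore] -/
theorem dyScale_zero : dyScale 0 = 1 := by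
  unfold dyScale; simp

/-! ### The dyadic bumps -/

/-- The inner coordinate `2 log v / log 2 − ℓ = 2 log₂ v − ℓ`. [folklore] -/
def dyInner (ℓ : ℤ) (v : ℝ) : ℝ := -(ℓ : ℝ) + 2 / Real.log 2 * Real.log v

/-- The real dyadic bump `β(2 log₂ v − ℓ)` (`0` for `v ≤ 0`). [cite: Ngo2024, §3.5 Proposition 3.18 (proof)] -/
def dyadicR (ℓ : ℤ) (v : ℝ) : ℝ := if 0 < v then unitPartition (dyInner ℓ v) else 0

/-- The dyadic bump as a complex-valued function. [folklore] -/
def dyadic (ℓ : ℤ) (v : ℝ) : ℂ := ((dyadicR ℓ v : ℝ) : ℂ)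

/-- `0 ≤ dyadicR`. [folklore] -/
theorem dyadicR_nonneg (ℓ : ℤ) (v : ℝ) : 0 ≤ dyadicR ℓ v := by
  unfold dyadicR; split_ifs
  · exact unitPartition_nonneg _
  · exact le_rfl

/-- `dyadicR ≤ 1`. [folklore] -/
theorem dyadicR_le_one (ℓ : ℤ) (v : ℝ) : dyadicR ℓ v ≤ 1 := by
  unfold dyadicR; split_ifs
  · exact unitPartition_le_one _
  · exact zero_le_one

/-- `‖dyadic‖ ≤ 1`. [folklore] -/
theorem norm_dyadic_le_one (ℓ : ℤ) (v : ℝ) : ‖dyadic ℓ v‖ ≤ 1 := by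
  rw [dyadic, Complex.norm_real, Real.norm_eq_abs, abs_of_nonneg (dyadicR_nonneg ℓ v)]
  exact dyadicR_le_one ℓ v

/-- `conj dyadic = dyadic` (real values). [folklore] -/
theorem conj_dyadic (ℓ : ℤ) (v : ℝ) : conj (dyadic ℓ v) = dyadic ℓ v := by
  rw [dyadic, Complex.conj_ofReal]

/-- For `v > 0`: `dyadic ℓ v = β_ℂ(2 log₂ v − ℓ)`. [folklore] -/
theorem dyadic_of_pos (ℓ : ℤ) {v : ℝ} (hv : 0 < v) : dyadic ℓ v = unitPartitionC (dyInner ℓ v) := by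
  rw [dyadic, dyadicR, if_pos hv, unitPartitionC]

/-- For `v ≤ 0`: `dyadic ℓ v = 0`. [folklore] -/
theorem dyadic_of_nonpos (ℓ : ℤ) {v : ℝ} (hv : v ≤ 0) : dyadic ℓ v = 0 := by
  rw [dyadic, dyadicR, if_neg (not_lt.2 hv), Complex.ofReal_zero]

/-- **Support**: `dyadic ℓ v ≠ 0 ⇒ K_ℓ < v < 2K_ℓ`. [folklore] -/
theorem dyadic_support {ℓ : ℤ} {v : ℝ} (h : dyadic ℓ v ≠ 0) : dyScale ℓ < v ∧ v < 2 * dyScale ℓ := by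
  by_cases hv : 0 < v
  · rw [dyadic_of_pos ℓ hv, unitPartitionC] at h
    have h' : unitPartition (dyInner ℓ v) ≠ 0 := fun h0 => h (by rw [h0, Complex.ofReal_zero])
    obtain ⟨h1, h2⟩ := pos_lt_two_of_unitPartition_ne_zero h'
    have hl2 : 0 < Real.log 2 := Real.log_pos one_lt_two
    unfold dyInner at h1 h2
    have e : 2 / Real.log 2 * Real.log v * (Real.log 2 / 2) = Real.log v := by field_simp
    constructor
    · rw [← Real.log_lt_log_iff (dyScale_pos ℓ) hv, log_dyScale]
      have h3 : (ℓ : ℝ) < 2 / Real.log 2 * Real.log v := by linarith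
      calc (ℓ : ℝ) / 2 * Real.log 2 = ℓ * (Real.log 2 / 2) := by ring
        _ < 2 / Real.log 2 * Real.log v * (Real.log 2 / 2) := mul_lt_mul_of_pos_right h3 (by positivity)
        _ = Real.log v := e
    · rw [← Real.log_lt_log_iff hv (mul_pos two_pos (dyScale_pos ℓ)),
        Real.log_mul two_ne_zero (dyScale_pos ℓ).ne',
        log_dyScale]
      have h3 : 2 / Real.log 2 * Real.log v < ℓ + 2 := by linarith
      calc Real.log v = 2 / Real.log 2 * Real.log v * (Real.log 2 / 2) := e.symm
        _ < ((ℓ : ℝ) + 2) * (Real.log 2 / 2) := mul_lt_mul_of_pos_right h3 (by positivity)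
        _ = Real.log 2 + ℓ / 2 * Real.log 2 := by ring
  · exact absurd (dyadic_of_nonpos ℓ (not_lt.1 hv)) h

/-- `dyadic ℓ v = 0` unless `K_ℓ < v < 2K_ℓ`. [folklore] -/
theorem dyadic_eq_zero_of_not {ℓ : ℤ} {v : ℝ} (h : ¬ (dyScale ℓ < v ∧ v < 2 * dyScale ℓ)) :
    dyadic ℓ v = 0 := by
  by_contra hne; exact h (dyadic_support hne)

/-- `dyadicR ℓ v = 0` unless `K_ℓ < v < 2K_ℓ`. [folklore] -/
theorem dyadicR_eq_zero_of_not {ℓ : ℤ} {v : ℝ} (h : ¬ (dyScale ℓ < v ∧ v < 2 * dyScale ℓ)) :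
    dyadicR ℓ v = 0 := by
  have := dyadic_eq_zero_of_not h
  rwa [dyadic, Complex.ofReal_eq_zero] at this

/-- **Partition of unity**: `∑_{ℓ ∈ ℤ} dyadic ℓ v = 1` for `v > 0`. [cite: Ngo2024, §3.4 Lemma 3.11] -/
theorem tsum_dyadic {v : ℝ} (hv : 0 < v) : ∑' ℓ : ℤ, dyadic ℓ v = 1 := by
  have h := tsum_unitPartition_sub_int (2 / Real.log 2 * Real.log v)
  have hfun : (fun ℓ : ℤ => dyadic ℓ v) =
      fun ℓ : ℤ => ((unitPartition (2 / Real.log 2 * Real.log v - ℓ) : ℝ) : ℂ) := by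
    funext ℓ
    rw [dyadic_of_pos ℓ hv, unitPartitionC, dyInner, neg_add_eq_sub]
  rw [hfun, ← Complex.ofReal_tsum, h, Complex.ofReal_one]

/-- Below the range: `ℓ ≤ −2` and `v ≥ 1` give `dyadic ℓ v = 0`. [folklore] -/
theorem dyadic_eq_zero_of_le_neg_two {ℓ : ℤ} (hℓ : ℓ ≤ -2) {v : ℝ} (hv : 1 ≤ v) : dyadic ℓ v = 0 := by
  apply dyadic_eq_zero_of_not
  rintro ⟨-, h2⟩
  have : dyScale ℓ ≤ 1 / 2 := dyScale_neg_two ▸ dyScale_mono hℓ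
  linarith

/-- Above the range: `v ≤ K_{L+1}` and `ℓ ≥ L + 1` give `dyadic ℓ v = 0`. [folklore] -/
theorem dyadic_eq_zero_of_lt {L ℓ : ℤ} (hℓ : L + 1 ≤ ℓ) {v : ℝ} (hv : v ≤ dyScale (L + 1)) :
    dyadic ℓ v = 0 := by
  apply dyadic_eq_zero_of_not
  rintro ⟨h1, -⟩
  have : dyScale (L + 1) ≤ dyScale ℓ := dyScale_mono hℓ
  linarith

/-- **Finite partition of unity**: for `1 ≤ v ≤ K_{L+1}`, `∑_{−1 ≤ ℓ ≤ L} dyadic ℓ v = 1`. [folklore] -/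
theorem sum_dyadic_eq_one {v : ℝ} (hv : 1 ≤ v) {L : ℤ} (hvL : v ≤ dyScale (L + 1)) :
    ∑ ℓ ∈ Finset.Icc (-1) L, dyadic ℓ v = 1 := by
  rw [← tsum_dyadic (by linarith : 0 < v), tsum_eq_sum]
  intro ℓ hℓ
  rw [Finset.mem_Icc, not_and_or, not_le, not_le] at hℓ
  rcases hℓ with h | h
  · exact dyadic_eq_zero_of_le_neg_two (by omega) hv
  · exact dyadic_eq_zero_of_lt (by omega) hvL

/-- The real version: `∑_{−1 ≤ ℓ ≤ L} dyadicR ℓ v = 1` for `1 ≤ v ≤ K_{L+1}`. [folklore] -/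
theorem sum_dyadicR_eq_one {v : ℝ} (hv : 1 ≤ v) {L : ℤ} (hvL : v ≤ dyScale (L + 1)) :
    ∑ ℓ ∈ Finset.Icc (-1) L, dyadicR ℓ v = 1 := by
  have h := sum_dyadic_eq_one hv hvL
  simp only [dyadic] at h
  exact_mod_cast h

/-- **Partial sums are in `[0, 1]`**: `0 ≤ ∑_{−1 ≤ ℓ ≤ L} dyadicR ℓ v ≤ 1` for `v ≥ 1`. [folklore] -/
theorem sum_dyadicR_mem {v : ℝ} (hv : 1 ≤ v) (L : ℤ) :
    0 ≤ ∑ ℓ ∈ Finset.Icc (-1) L, dyadicR ℓ v ∧ ∑ ℓ ∈ Finset.Icc (-1) L, dyadicR ℓ v ≤ 1 := by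
  refine ⟨Finset.sum_nonneg fun ℓ _ => dyadicR_nonneg ℓ v, ?_⟩
  -- choose `L' ≥ L` with `v ≤ K_{L'+1}`
  obtain ⟨L', hLL', hvL'⟩ : ∃ L' : ℤ, L ≤ L' ∧ v ≤ dyScale (L' + 1) := by
    obtain ⟨n, hn⟩ := exists_nat_gt (2 / Real.log 2 * Real.log v)
    refine ⟨max L n, le_max_left _ _, ?_⟩
    have hv0 : 0 < v := by linarith
    rw [← Real.log_le_log_iff hv0 (dyScale_pos _), log_dyScale]
    have hl2 : 0 < Real.log 2 := Real.log_pos one_lt_two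
    have e : 2 / Real.log 2 * Real.log v * (Real.log 2 / 2) = Real.log v := by field_simp
    have h1 : 2 / Real.log 2 * Real.log v ≤ ((max L n : ℤ) : ℝ) + 1 := by
      have : (n : ℝ) ≤ ((max L n : ℤ) : ℝ) := by exact_mod_cast le_max_right L n
      linarith
    calc Real.log v = 2 / Real.log 2 * Real.log v * (Real.log 2 / 2) := e.symm
      _ ≤ (((max L n : ℤ) : ℝ) + 1) * (Real.log 2 / 2) := mul_le_mul_of_nonneg_right h1 (by positivity)
      _ = (((max L n + 1 : ℤ) : ℝ)) / 2 * Real.log 2 := by push_cast; ring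
  calc ∑ ℓ ∈ Finset.Icc (-1) L, dyadicR ℓ v ≤ ∑ ℓ ∈ Finset.Icc (-1) L', dyadicR ℓ v :=
        Finset.sum_le_sum_of_subset_of_nonneg (Finset.Icc_subset_Icc le_rfl hLL')
          fun ℓ _ _ => dyadicR_nonneg ℓ v
    _ = 1 := sum_dyadicR_eq_one hv hvL'

/-! ### Smoothness and derivative bounds of the dyadic bumps -/

/-- Near a point `v < K_ℓ` the bump vanishes identically. [folklore] -/
theorem dyadic_eventuallyEq_zero_of_lt {ℓ : ℤ} {v : ℝ} (hv : v < dyScale ℓ) :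
    dyadic ℓ =ᶠ[nhds v] fun _ => (0 : ℂ) := by
  filter_upwards [(isOpen_Iio (a := dyScale ℓ)).mem_nhds hv] with w hw
  exact dyadic_eq_zero_of_not fun h => absurd h.1 (not_lt.2 (le_of_lt hw))

/-- Near a point `v > 2K_ℓ` the bump vanishes identically. [folklore] -/
theorem dyadic_eventuallyEq_zero_of_gt {ℓ : ℤ} {v : ℝ} (hv : 2 * dyScale ℓ < v) :
    dyadic ℓ =ᶠ[nhds v] fun _ => (0 : ℂ) := by
  filter_upwards [(isOpen_Ioi (a := 2 * dyScale ℓ)).mem_nhds hv] with w hw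
  exact dyadic_eq_zero_of_not fun h => absurd h.2 (not_lt.2 (le_of_lt hw))

/-- On `v > 0` the bump is the smooth composite `β_ℂ ∘ dyInner`. [folklore] -/
theorem dyadic_eventuallyEq_comp {ℓ : ℤ} {v : ℝ} (hv : 0 < v) :
    dyadic ℓ =ᶠ[nhds v] fun w => unitPartitionC (dyInner ℓ w) := by
  filter_upwards [(isOpen_Ioi (a := (0 : ℝ))).mem_nhds hv] with w hw
  exact dyadic_of_pos ℓ hw

/-- `dyInner ℓ` is smooth on `(0, ∞)`. [folklore] -/
theorem contDiffOn_dyInner (ℓ : ℤ) {n : ℕ∞} : ContDiffOn ℝ n (dyInner ℓ) (Set.Ioi 0) := by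
  intro v hv
  have h : ContDiffAt ℝ n (dyInner ℓ) v :=
    contDiffAt_const.add (contDiffAt_const.mul (Real.contDiffAt_log.2 (ne_of_gt hv)))
  exact h.contDiffWithinAt

/-- **The dyadic bumps are smooth on `ℝ`.** [folklore] -/
theorem contDiff_dyadic (ℓ : ℤ) {n : ℕ∞} : ContDiff ℝ n (dyadic ℓ) := by
  refine contDiff_iff_contDiffAt.2 fun v => ?_
  by_cases hv : v < dyScale ℓ
  · exact (contDiffAt_const (c := (0 : ℂ))).congr_of_eventuallyEq (dyadic_eventuallyEq_zero_of_lt hv)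
  · have hv0 : 0 < v := (dyScale_pos ℓ).trans_le (not_lt.1 hv)
    have hin : ContDiffAt ℝ n (dyInner ℓ) v :=
      contDiffAt_const.add (contDiffAt_const.mul (Real.contDiffAt_log.2 hv0.ne'))
    exact (contDiff_unitPartitionC.contDiffAt.comp v hin).congr_of_eventuallyEq
      (dyadic_eventuallyEq_comp hv0)

/-- `dyInner` through the tree's `log|c s + d|` calculus (`c = 1`, `d = 0`). [folklore] -/
theorem dyInner_eq (ℓ : ℤ) :
    dyInner ℓ = fun v => -(ℓ : ℝ) + 2 / Real.log 2 * Real.log |1 * v + 0| := by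
  funext v; rw [dyInner, one_mul, add_zero, Real.log_abs]

/-- `2/log 2 ≤ 3`. [folklore] -/
theorem two_div_log_two_le_three : 2 / Real.log 2 ≤ 3 := by
  have h := Real.log_two_gt_d9
  rw [div_le_iff₀ (by linarith)]
  linarith

/-- **Derivatives of the inner coordinate**: for `v ≠ 0` and `1 ≤ i ≤ n`,
`‖∂ⁱ dyInner ℓ (v)‖ ≤ ((3n + 3)/|v|)ⁱ` (`∂ⁱ log v = ±(i−1)!/vⁱ`, `(i−1)! ≤ (n+1)^{i−1}`,
`2/log 2 ≤ 3`). [folklore] -/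
theorem norm_iteratedDeriv_dyInner_le (ℓ : ℤ) {v : ℝ} (hv : v ≠ 0) {i n : ℕ} (hi : 1 ≤ i)
    (hin : i ≤ n) :
    ‖iteratedDeriv i (dyInner ℓ) v‖ ≤ ((3 * n + 3) / |v|) ^ i := by
  obtain ⟨k, rfl⟩ : ∃ k, i = k + 1 := ⟨i - 1, by omega⟩
  have hv' : 1 * v + 0 ≠ 0 := by simpa using hv
  rw [dyInner_eq, iteratedDeriv_const_add (Nat.succ_pos k), iteratedDeriv_const_mul_field,
    norm_mul, Real.norm_eq_abs, abs_of_pos (by positivity : (0 : ℝ) < 2 / Real.log 2)]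
  have h1 := norm_iteratedDeriv_log_abs_linear_le k 1 0 hv'
  rw [abs_one, one_pow, one_mul, add_zero] at h1
  have hv0 : 0 < |v| := abs_pos.2 hv
  have hkf : (k.factorial : ℝ) ≤ (n : ℝ) ^ k := factorial_le_pow_of_le (by omega)
  have hn1 : (n : ℝ) ^ k ≤ (3 * n + 3) ^ k :=
    pow_le_pow_left₀ (Nat.cast_nonneg _) (by linarith [(Nat.cast_nonneg n : (0 : ℝ) ≤ n)]) k
  calc 2 / Real.log 2 * ‖iteratedDeriv (k + 1) (fun s => Real.log |1 * s + 0|) v‖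
      ≤ 3 * ((k.factorial : ℝ) / |v| ^ (k + 1)) := by
        refine mul_le_mul two_div_log_two_le_three ?_ (norm_nonneg _) (by norm_num)
        simpa [div_eq_mul_inv] using h1
    _ ≤ 3 * ((3 * n + 3) ^ k / |v| ^ (k + 1)) := by
        gcongr
        exact hkf.trans hn1
    _ ≤ (3 * n + 3) * ((3 * n + 3) ^ k / |v| ^ (k + 1)) :=
        mul_le_mul_of_nonneg_right (by linarith [(Nat.cast_nonneg n : (0 : ℝ) ≤ n)])
          (by positivity)
    _ = ((3 * n + 3) / |v|) ^ (k + 1) := by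
        rw [div_pow, pow_succ]; ring

/-- **Derivative bound for the dyadic bumps**: if `‖β_ℂ⁽ⁱ⁾‖ ≤ M` for `i ≤ n`, then for `v > 0`
and `j ≤ n`, `‖∂ʲ dyadic ℓ (v)‖ ≤ j! M ((3n+3)/v)ʲ`. [cite: Ngo2024, §3.5 Lemma 3.17] -/
theorem norm_iteratedDeriv_dyadic_le {n : ℕ} {M : ℝ}
    (hM : ∀ i ≤ n, ∀ s : ℝ, ‖iteratedDeriv i unitPartitionC s‖ ≤ M) (ℓ : ℤ) {v : ℝ} (hv : 0 < v)
    {j : ℕ} (hj : j ≤ n) :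
    ‖iteratedDeriv j (dyadic ℓ) v‖ ≤ j.factorial * M * ((3 * n + 3) / v) ^ j := by
  rw [(dyadic_eventuallyEq_comp (ℓ := ℓ) hv).iteratedDeriv_eq]
  have h := norm_iteratedDeriv_unitPartitionC_comp_le (f := dyInner ℓ) (U := Set.Ioi 0) isOpen_Ioi
    (contDiffOn_dyInner ℓ) hv (n := j) (M := M) (D := (3 * n + 3) / |v|)
    (fun i hi s => hM i (hi.trans hj) s)
    (fun i hi1 hij => norm_iteratedDeriv_dyInner_le ℓ hv.ne' hi1 (hij.trans hj))
  rwa [abs_of_pos hv] at h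

/-- The derivatives of a bump vanish at points `v < K_ℓ`. [folklore] -/
theorem iteratedDeriv_dyadic_eq_zero_of_lt {ℓ : ℤ} {v : ℝ} (hv : v < dyScale ℓ) (j : ℕ) :
    iteratedDeriv j (dyadic ℓ) v = 0 := by
  rw [(dyadic_eventuallyEq_zero_of_lt hv).iteratedDeriv_eq, iteratedDeriv_const]
  split_ifs <;> rfl

/-- The derivatives of a bump vanish at points `v > 2K_ℓ`. [folklore] -/
theorem iteratedDeriv_dyadic_eq_zero_of_gt {ℓ : ℤ} {v : ℝ} (hv : 2 * dyScale ℓ < v) (j : ℕ) :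
    iteratedDeriv j (dyadic ℓ) v = 0 := by
  rw [(dyadic_eventuallyEq_zero_of_gt hv).iteratedDeriv_eq, iteratedDeriv_const]
  split_ifs <;> rfl

/-- **Uniform derivative bound on the support scale**: for `v ≥ K_ℓ` and `j ≤ n`,
`‖∂ʲ dyadic ℓ (v)‖ ≤ j! M (3n+3)ʲ K_ℓ^{−j}`; for `v < K_ℓ` the derivative vanishes. Hence for
all real `v`: `‖∂ʲ dyadic ℓ (v)‖ ≤ n! M (3n+3)ⁿ′… ` — we record the clean form
`≤ j! M ((3n+3)/K_ℓ)ʲ`. [cite: Ngo2024, §3.5 Lemma 3.17] -/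
theorem norm_iteratedDeriv_dyadic_le_scale {n : ℕ} {M : ℝ} (hM0 : 0 ≤ M)
    (hM : ∀ i ≤ n, ∀ s : ℝ, ‖iteratedDeriv i unitPartitionC s‖ ≤ M) (ℓ : ℤ) (v : ℝ)
    {j : ℕ} (hj : j ≤ n) :
    ‖iteratedDeriv j (dyadic ℓ) v‖ ≤ j.factorial * M * ((3 * n + 3) / dyScale ℓ) ^ j := by
  by_cases hv : v < dyScale ℓ
  · rw [iteratedDeriv_dyadic_eq_zero_of_lt hv, norm_zero]
    have := dyScale_pos ℓ
    positivity
  · have hKv : dyScale ℓ ≤ v := not_lt.1 hv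
    have hv0 : 0 < v := (dyScale_pos ℓ).trans_le hKv
    refine (norm_iteratedDeriv_dyadic_le hM ℓ hv0 hj).trans ?_
    have h1 : (3 * n + 3) / v ≤ (3 * (n : ℝ) + 3) / dyScale ℓ :=
      div_le_div_of_nonneg_left (by positivity) (dyScale_pos ℓ) hKv
    have h2 : 0 ≤ (3 * (n : ℝ) + 3) / v := by positivity
    exact mul_le_mul_of_nonneg_left (pow_le_pow_left₀ h2 h1 j) (by positivity)

/-! ### Rescaled bumps `v ↦ dyadic ℓ (λv)` (support `(K_ℓ/λ, 2K_ℓ/λ)`) -/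

/-- Support of a rescaled bump: `dyadic ℓ (λv) ≠ 0 ⇒ K_ℓ/λ < v < 2K_ℓ/λ` (`λ > 0`). [folklore] -/
theorem dyadic_scaled_support {ℓ : ℤ} {lam v : ℝ} (hlam : 0 < lam) (h : dyadic ℓ (lam * v) ≠ 0) :
    dyScale ℓ / lam < v ∧ v < 2 * (dyScale ℓ / lam) := by
  obtain ⟨h1, h2⟩ := dyadic_support h
  constructor
  · rw [div_lt_iff₀ hlam, mul_comm]; exact h1
  · rw [mul_div_assoc', lt_div_iff₀ hlam, mul_comm v]; exact h2

/-- Near a point `v < K_ℓ/λ` the rescaled bump vanishes identically. [folklore] -/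
theorem dyadic_scaled_eventuallyEq_zero_of_lt {ℓ : ℤ} {lam v : ℝ} (hlam : 0 < lam)
    (hv : v < dyScale ℓ / lam) :
    (fun w => dyadic ℓ (lam * w)) =ᶠ[nhds v] fun _ => (0 : ℂ) := by
  filter_upwards [(isOpen_Iio (a := dyScale ℓ / lam)).mem_nhds hv] with w hw
  exact dyadic_eq_zero_of_not fun h => absurd h.1 (not_lt.2 (by
    have : lam * w < dyScale ℓ := by rwa [Set.mem_Iio, lt_div_iff₀ hlam, mul_comm] at hw
    exact this.le))

/-- Near a point `v > 2K_ℓ/λ` the rescaled bump vanishes identically. [folklore] -/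
theorem dyadic_scaled_eventuallyEq_zero_of_gt {ℓ : ℤ} {lam v : ℝ} (hlam : 0 < lam)
    (hv : 2 * (dyScale ℓ / lam) < v) :
    (fun w => dyadic ℓ (lam * w)) =ᶠ[nhds v] fun _ => (0 : ℂ) := by
  filter_upwards [(isOpen_Ioi (a := 2 * (dyScale ℓ / lam))).mem_nhds hv] with w hw
  exact dyadic_eq_zero_of_not fun h => absurd h.2 (not_lt.2 (by
    have : 2 * dyScale ℓ < lam * w := by
      rw [Set.mem_Ioi, mul_div_assoc', div_lt_iff₀ hlam] at hw; linarith
    exact this.le))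

/-- A rescaled bump is smooth. [folklore] -/
theorem contDiff_dyadic_scaled (ℓ : ℤ) (lam : ℝ) {n : ℕ∞} :
    ContDiff ℝ n (fun w => dyadic ℓ (lam * w)) :=
  (contDiff_dyadic ℓ).comp (contDiff_const.mul contDiff_id)

/-- Derivatives of a rescaled bump: `∂ʲ[dyadic ℓ (λ·)](v) = λʲ ∂ʲ(dyadic ℓ)(λv)`. [folklore] -/
theorem iteratedDeriv_dyadic_scaled (ℓ : ℤ) (lam : ℝ) (j : ℕ) (v : ℝ) :
    iteratedDeriv j (fun w => dyadic ℓ (lam * w)) v = lam ^ j • iteratedDeriv j (dyadic ℓ) (lam * v) := by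
  rw [iteratedDeriv_comp_const_smul (contDiff_dyadic ℓ (n := (j : ℕ∞))) lam]

/-- **Derivative bound for rescaled bumps**: with `C = K_ℓ/λ`,
`‖∂ʲ[dyadic ℓ (λ·)](v)‖ ≤ j! M ((3n+3)/C)ʲ` for all real `v` (`j ≤ n`). [cite: Ngo2024, §3.5 Lemma 3.17] -/
theorem norm_iteratedDeriv_dyadic_scaled_le {n : ℕ} {M : ℝ} (hM0 : 0 ≤ M)
    (hM : ∀ i ≤ n, ∀ s : ℝ, ‖iteratedDeriv i unitPartitionC s‖ ≤ M) (ℓ : ℤ) {lam : ℝ}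
    (hlam : 0 < lam) (v : ℝ) {j : ℕ} (hj : j ≤ n) :
    ‖iteratedDeriv j (fun w => dyadic ℓ (lam * w)) v‖ ≤
      j.factorial * M * ((3 * n + 3) / (dyScale ℓ / lam)) ^ j := by
  rw [iteratedDeriv_dyadic_scaled, norm_smul, norm_pow, Real.norm_eq_abs, abs_of_pos hlam]
  refine (mul_le_mul_of_nonneg_left (norm_iteratedDeriv_dyadic_le_scale hM0 hM ℓ (lam * v) hj)
    (by positivity)).trans (le_of_eq ?_)
  rw [div_div_eq_mul_div, show ((3 : ℝ) * n + 3) * lam / dyScale ℓ = lam * ((3 * n + 3) / dyScale ℓ) by ring,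
    mul_pow]
  ring

/-! ### Sign symmetries of the column function and of the dual terms -/

section symmetry

variable {R : BinQF} {a : ℤ}

/-- **`conj colFn^{[h]} = colFn^{[−h]}`** (the plateau and Tóth's weight are real; only the Hooley
phase `e(hΦ)` is conjugated). [folklore] -/
theorem conj_colFn (R : BinQF) (a b : ℤ) (x Y₁ : ℝ) (h : ℤ) (L : ℝ) (m : ℤ) (u t : ℝ) :
    conj (colFn R a b x Y₁ h L m u t) = colFn R a b x Y₁ (-h) L m u t := by
  unfold colFn
  split_ifs
  · exact map_zero _
  · rw [map_mul, map_mul, Complex.conj_ofReal, Complex.conj_ofReal, conj_ex,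
      show (((-h : ℤ) : ℝ) * colPhi R b u t) = -((h : ℝ) * colPhi R b u t) by push_cast; ring]

/-- **`conj 𝓕f(w) = 𝓕(conj ∘ f)(−w)`.** [folklore] -/
theorem conj_fourier (f : ℝ → ℂ) (w : ℝ) : conj (𝓕 f w) = 𝓕 (fun t => conj (f t)) (-w) := by
  rw [Real.fourier_real_eq, Real.fourier_real_eq, ← integral_conj]
  refine integral_congr_ae (Filter.Eventually.of_forall fun t => ?_)
  have conj_fc : ∀ y : ℝ, starRingEnd ℂ (𝐞 y : ℂ) = (𝐞 (-y) : ℂ) := fun y => by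
    rw [← Circle.coe_inv_eq_conj, AddChar.map_neg_eq_inv]
  simp only [Circle.smul_def, smul_eq_mul, map_mul, conj_fc]
  rw [show -(-(t * w)) = -(t * -w) by ring]

/-- **`F_α^{[h]}(−κ) = conj F_α^{[−h]}(κ)`** for the dual terms
`F_α^{[h]}(κ) = 𝓕(colFn^{[h]}(α,·))(κ/M_α) · S_α(h, κ)`: negative frequencies are the conjugates of
positive frequencies for the opposite `h`. [cite: Ngo2024, §2.2 (remark after Theorem 2.5: `κ < 0` by conjugation)] -/
theorem dualTerm_neg_right (a : ℤ) (d : ℕ) (R : BinQF) (b : ℤ) (x Y₁ : ℝ) (h : ℤ) (L : ℝ) (m : ℤ)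
    (α κ : ℤ) :
    𝓕 (fun t => colFn R a b x Y₁ h L m α t) (((-κ : ℤ) : ℝ) / ((α.natAbs * (a.toNat * d) : ℕ) : ℝ)) *
        colExpSum a d R h α (-κ) =
      conj (𝓕 (fun t => colFn R a b x Y₁ (-h) L m α t)
          ((κ : ℝ) / ((α.natAbs * (a.toNat * d) : ℕ) : ℝ)) * colExpSum a d R (-h) α κ) := by
  rw [map_mul, conj_fourier, conj_colExpSum, neg_neg]
  simp_rw [conj_colFn, neg_neg]
  rw [show (((-κ : ℤ) : ℝ) / ((α.natAbs * (a.toNat * d) : ℕ) : ℝ)) =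
    -((κ : ℝ) / ((α.natAbs * (a.toNat * d) : ℕ) : ℝ)) by push_cast; ring]

/-- **`𝓕(colFn(−u,·))(w) = 𝓕(colFn(u,·))(−w)`** (`colFn(−u, t) = colFn(u, −t)` and `t ↦ −t`).
[folklore] -/
theorem fourier_colFn_neg_left (R : BinQF) (a b : ℤ) (x Y₁ : ℝ) (h : ℤ) (L : ℝ) (m : ℤ) (u w : ℝ) :
    𝓕 (fun t => colFn R a b x Y₁ h L m (-u) t) w = 𝓕 (fun t => colFn R a b x Y₁ h L m u t) (-w) := by
  have hfun : (fun t => colFn R a b x Y₁ h L m (-u) t) = fun t => colFn R a b x Y₁ h L m u (-t) := by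
    funext t
    rw [← colFn_neg_neg R a b x Y₁ h L m (-u) t, neg_neg]
  rw [hfun, Real.fourier_real_eq, Real.fourier_real_eq]
  have hsub := Measure.integral_comp_mul_left
    (fun v => 𝐞 (-(v * -w)) • colFn R a b x Y₁ h L m u v) (-1 : ℝ)
  rw [inv_neg, inv_one, abs_neg, abs_one, one_smul] at hsub
  rw [← hsub]
  refine integral_congr_ae (Filter.Eventually.of_forall fun v => ?_)
  simp only [neg_one_mul]
  rw [show -(v * w) = -(-v * -w) by ring]

/-- **The weighted dual column** `D_w(α) = M_α⁻¹ ∑_κ 𝓕(colFn(α,·))(κ/M_α) S_α(h,κ) w(κ)` for a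
weight `w` on the frequencies (`w = 1` is the dual form of `tothSum_eq_dualSum`).
[cite: Ngo2024, §3.5 Lemma 3.15, Proposition 3.18] -/
def dualCol (a : ℤ) (d : ℕ) (R : BinQF) (b : ℤ) (x Y₁ : ℝ) (h : ℤ) (L : ℝ) (m : ℤ) (w : ℤ → ℂ)
    (α : ℤ) : ℂ :=
  (((α.natAbs * (a.toNat * d) : ℕ) : ℂ))⁻¹ *
    ∑' κ : ℤ, 𝓕 (fun t => colFn R a b x Y₁ h L m α t)
        ((κ : ℝ) / ((α.natAbs * (a.toNat * d) : ℕ) : ℝ)) * colExpSum a d R h α κ * w κ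

/-- **Evenness in `α`**: for an even weight `w`, `D_w(−α) = D_w(α)` (`M_{−α} = M_α`,
`𝓕(colFn(−α,·))(κ/M) = 𝓕(colFn(α,·))(−κ/M)`, `S_{−α}(h,κ) = S_α(h,−κ)`, and `κ ↦ −κ`). [folklore] -/
theorem dualCol_neg (ha : 0 < a) (d : ℕ) (R : BinQF) (b : ℤ) (x Y₁ : ℝ) (h : ℤ) (L : ℝ) (m : ℤ)
    {w : ℤ → ℂ} (hw : ∀ κ, w (-κ) = w κ) {α : ℤ} (hα : α ≠ 0) :
    dualCol a d R b x Y₁ h L m w (-α) = dualCol a d R b x Y₁ h L m w α := by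
  unfold dualCol
  rw [Int.natAbs_neg]
  congr 1
  set M : ℕ := α.natAbs * (a.toNat * d) with hM
  set G : ℤ → ℂ := fun κ => 𝓕 (fun t => colFn R a b x Y₁ h L m α t) ((κ : ℝ) / (M : ℝ)) *
    colExpSum a d R h α κ * w κ with hG
  have hG' : ∀ κ : ℤ, 𝓕 (fun t => colFn R a b x Y₁ h L m ((-α : ℤ) : ℝ) t) ((κ : ℝ) / (M : ℝ)) *
      colExpSum a d R h (-α) κ * w κ = G (Equiv.neg ℤ κ) := by
    intro κ
    rw [Equiv.neg_apply, hG]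
    simp only
    rw [Int.cast_neg, fourier_colFn_neg_left, colExpSum_neg_left ha d R h hα, hw,
      show (((-κ : ℤ) : ℝ) / (M : ℝ)) = -((κ : ℝ) / (M : ℝ)) by push_cast; ring]
  rw [tsum_congr hG', Equiv.tsum_eq]

/-- **`∑_{0<|α|≤A} g(α) = ∑_{1≤α≤A} (g(α) + g(−α))`.** [folklore] -/
theorem sum_Icc_erase_zero_eq {M : Type*} [AddCommMonoid M] (g : ℤ → M) (A : ℤ) :
    ∑ α ∈ (Finset.Icc (-A) A).erase 0, g α = ∑ α ∈ Finset.Icc 1 A, (g α + g (-α)) := by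
  rw [Finset.sum_add_distrib]
  have hsplit : (Finset.Icc (-A) A).erase 0 =
      Finset.Icc 1 A ∪ (Finset.Icc 1 A).image (fun α => -α) := by
    ext α
    simp only [Finset.mem_erase, Finset.mem_Icc, Finset.mem_union, Finset.mem_image]
    constructor
    · rintro ⟨h0, h1, h2⟩
      rcases lt_or_gt_of_ne h0 with h | h
      · exact Or.inr ⟨-α, ⟨by omega, by omega⟩, by omega⟩
      · exact Or.inl ⟨by omega, h2⟩
    · rintro (⟨h1, h2⟩ | ⟨β, ⟨h1, h2⟩, rfl⟩)
      · exact ⟨by omega, by omega, h2⟩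
      · exact ⟨by omega, by omega, by omega⟩
  have hdisj : Disjoint (Finset.Icc 1 A) ((Finset.Icc 1 A).image (fun α => -α)) := by
    rw [Finset.disjoint_left]
    intro α hα hα'
    rw [Finset.mem_image] at hα'
    obtain ⟨β, hβ, rfl⟩ := hα'
    rw [Finset.mem_Icc] at hα hβ
    omega
  rw [hsplit, Finset.sum_union hdisj, Finset.sum_image fun x _ y _ hxy => neg_injective hxy]

/-- **`∑_{0<|α|≤A} D_w(α) = 2 ∑_{1≤α≤A} D_w(α)`** for an even weight `w`. [folklore] -/
theorem sum_dualCol_eq_two_mul (ha : 0 < a) (d : ℕ) (R : BinQF) (b : ℤ) (x Y₁ : ℝ) (h : ℤ)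
    (L : ℝ) (m : ℤ) {w : ℤ → ℂ} (hw : ∀ κ, w (-κ) = w κ) (A : ℤ) :
    ∑ α ∈ (Finset.Icc (-A) A).erase 0, dualCol a d R b x Y₁ h L m w α =
      2 * ∑ α ∈ Finset.Icc 1 A, dualCol a d R b x Y₁ h L m w α := by
  rw [sum_Icc_erase_zero_eq, two_mul, ← Finset.sum_add_distrib]
  refine Finset.sum_congr rfl fun α hα => ?_
  rw [Finset.mem_Icc] at hα
  rw [dualCol_neg ha d R b x Y₁ h L m hw (by omega : α ≠ 0)]

end symmetry

end RootForms

end Literature.NumberTheory.Sieve
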